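import Literature.MathematicalPhysics.KineticTheory.DiPernaLionsExtractionHolds
import Mathlib.MeasureTheory.Function.ConvergenceInMeasure
import Mathlib.MeasureTheory.Integral.IntervalIntegral.IntegrationByParts
import HarnessLib

/-!
# Velocity averages of the DiPerna–Lions approximating sequence converge strongly (CIP Lemma 5.3.10–5.3.11 (i))

Topic: MathematicalPhysics / KineticTheory. First layer of the decomposition of the named fact
(S14) `diPernaLions_limit_isAEMildSolution` (`DiPernaLionsLimit`; reduced in
`DiPernaLionsMildLimitProofs` to (E49) `diPernaLions_limit_gain_le_loss` and (L12)
`diPernaLions_limit_expDuhamel`), following Cercignani–Illner–Pulvirenti 1994 §5.3 Steps 11–12: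
the consequences of the velocity averaging lemma (CIP Lemma 5.3.9, the named fact
`velocityAverage_relativelyCompact_L1` of `VelocityAveraging`) for the approximating sequence.
Everything in this file is **proved**; the velocity averaging lemma enters as the hypothesis
`(h9 : velocityAverage_relativelyCompact_L1)` of the final theorems.

* `hasDistribTransportOn_of_hasDerivAt_characteristics` (**proved**; the easy half of CIP Thm 5.A.1):
  a function which, along every characteristic `s ↦ (s, x + s v, v)`, is differentiable on `(0,T)`
  with continuous derivative `h♯`, solves `(∂ₜ + v·∇ₓ) u = h` in `𝒟'((0,T) × E × E)`
  (`HasDistribTransportOn`): free-flow coordinates (a measure-preserving shear) and an integration by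
  parts in time along each characteristic.
* `IsDiPernaLionsApproximateSolution.hasDistribTransportOn_logTrunc` (**proved**; CIP Lemma 5.3.10
  (ii) for `β_κ(s) = κ⁻¹ ln(1 + κ s)`): the renormalised approximate solutions solve
  `T β_κ(fⁿ) = β_κ'(fⁿ) Q̃ₙ(fⁿ,fⁿ)` in `𝒟'`, the right-hand side (`renormCollision`, written as
  `(1 + fⁿ)(1 + κ fⁿ)⁻¹ (Gₙ - Lₙ)` through the normalised weighted gain/loss terms `normGain`,
  `normLoss` of Lemma 5.3.7) being bounded by `κ⁻¹ (|Gₙ| + |Lₙ|)`, hence uniformly integrable on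
  compact subsets of the open slab by the proved Lemma 5.3.7
  (`uniformIntegrable_renormCollision_of_isCompact`).
* `integral_abs_sub_logTrunc_slab_le` (**proved**; (3.30)/(3.34)):
  `sup_n ‖fⁿ - β_κ(fⁿ)‖_{L¹((0,T) × E × E)} ≤ T (κ L + (log L)⁻¹) C`.
* `tendsto_integral_abs_velocityAverage_sub` (**proved**, granted `h9`; CIP Lemma 5.3.10 applied to
  the approximating sequence as in the proof of Lemma 5.3.11; Lions 1993 Thm III.4 (47)): along the
  extracted subsequence `f^{φ(k)} ⇀ f` (`IsDiPernaLionsWeakLimit`), for weights `ψₖ` bounded in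
  `L^∞((0,T) × E × E)` converging a.e. to `ψ`, `∫ f^{φ(k)} ψₖ dξ → ∫ f ψ dξ` in `L¹((0,T) × E)`
  — the whole sequence: along any subsequence, Lemma 5.3.9 gives `L¹` convergence of
  `∫ β_κ(fⁿ) ψₙ dξ` along a further subsequence, whose limit is identified (Dunford–Pettis, weak
  continuity of products with bounded a.e.-convergent factors, Fubini) as `∫ g_κ ψ dξ` with
  `‖f - g_κ‖₁ ≤ sup_n ‖fⁿ - β_κ(fⁿ)‖₁ → 0` (weak lower semicontinuity of the norm).
* `tendsto_integral_abs_velocityMass_sub`, `exists_subseq_velocityMass_tendsto_ae` (**proved**,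
  granted `h9`; CIP Lemma 5.3.11 (i)): `∫ f^{φ(k)} dξ → ∫ f dξ` in `L¹((0,T) × E)` for every `T`,
  and almost everywhere along one further subsequence for all `T` (diagonal extraction).

Infrastructure: Fubini between the slab `(0,T) × E × E` and its base `(0,T) × E` (`slabAssoc`,
`integrable_integral_velocity`, `integral_integral_velocity_mul`,
`tendstoWeaklyL1_velocityIntegral`, `integral_abs_velocityIntegral_sub_le`); domination and
restriction lemmas for `UnifIntegrable`/`UnifTight`/`UniformIntegrable`.

## References

* C. Cercignani, R. Illner, M. Pulvirenti, *The Mathematical Theory of Dilute Gases*, Springer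
  (1994), §5.3 Step 10 (3.30) (p. 151), Lemma 5.3.9 (p. 154), Lemma 5.3.10 with (3.34) and
  Lemma 5.3.11 (i) (pp. 155–156), Appendix 5.A Thm 5.A.1 (p. 164).
* P.-L. Lions, *Global solutions of kinetic models and related problems*, in: Nonequilibrium
  Problems in Many-Particle Systems, LNM 1551 (1993), Thm III.4 (47) (p. 57).
* R. J. DiPerna, P.-L. Lions, *On the Cauchy problem for Boltzmann equations: global existence and
  weak stability*, Ann. of Math. 130 (1989) 321–366.
-/

open MeasureTheory Metric Real Set Filter Topology
open scoped InnerProductSpace ENNReal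

noncomputable section

/-! ## Generic measure-theoretic helpers -/

namespace Literature.MathematicalPhysics.KineticTheory

section Helpers

variable {α : Type*} [MeasurableSpace α] {μ : Measure α}

/-- Equi-integrability passes to pointwise dominated families: `‖g i‖ ≤ ‖f i‖` a.e.
[folklore] -/
theorem unifIntegrable_of_ae_le {ι : Type*} {f g : ι → α → ℝ} (hf : UnifIntegrable f 1 μ)
    (h : ∀ i, ∀ᵐ x ∂μ, ‖g i x‖ ≤ ‖f i x‖) : UnifIntegrable g 1 μ := by
  refine Literature.Analysis.FunctionSpaces.unifIntegrable_of_dominated_split hf fun ε hε => ?_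
  refine ⟨1, 0, fun i => ⟨fun _ => 0, aemeasurable_const, by simp, ?_⟩⟩
  filter_upwards [h i] with x hx
  simp only [ENNReal.coe_one, one_mul, ENNReal.coe_zero, add_zero]
  rw [← ofReal_norm, ← ofReal_norm]
  exact ENNReal.ofReal_le_ofReal hx

/-- Uniform tightness passes to pointwise dominated families. [folklore] -/
theorem unifTight_of_ae_le {ι : Type*} {f g : ι → α → ℝ} (hf : UnifTight f 1 μ)
    (h : ∀ i, ∀ᵐ x ∂μ, ‖g i x‖ ≤ ‖f i x‖) : UnifTight g 1 μ := by
  refine Literature.Analysis.FunctionSpaces.unifTight_of_dominated_split hf fun ε hε => ?_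
  refine ⟨1, ∅, MeasurableSet.empty, by simp, fun i => ⟨fun _ => 0, aemeasurable_const, by simp, ?_⟩⟩
  filter_upwards [h i] with x hx _
  simp only [ENNReal.coe_one, one_mul, add_zero]
  rw [← ofReal_norm, ← ofReal_norm]
  exact ENNReal.ofReal_le_ofReal hx

/-- Uniform `L¹` bounds pass to pointwise dominated families. [folklore] -/
theorem uniformIntegrable_of_ae_le {ι : Type*} {f g : ι → α → ℝ} (hf : UniformIntegrable f 1 μ)
    (hg : ∀ i, AEStronglyMeasurable (g i) μ)
    (h : ∀ i, ∀ᵐ x ∂μ, ‖g i x‖ ≤ ‖f i x‖) : UniformIntegrable g 1 μ := by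
  obtain ⟨hfm, hfU, C, hC⟩ := hf
  refine ⟨hg, unifIntegrable_of_ae_le hfU h, C, fun i => le_trans ?_ (hC i)⟩
  exact eLpNorm_mono_ae (h i)

/-- Equi-integrability for a restricted measure passes to restrictions to measurable subsets.
[folklore] -/
theorem unifIntegrable_restrict_mono {ι : Type*} {f : ι → α → ℝ} {S K : Set α}
    (hf : UnifIntegrable f 1 (μ.restrict S)) (hK : MeasurableSet K) (hKS : K ⊆ S) :
    UnifIntegrable f 1 (μ.restrict K) := by
  intro ε hε
  obtain ⟨δ, hδ, h⟩ := hf hε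
  refine ⟨δ, hδ, fun i s hs hμs => ?_⟩
  have hle : μ.restrict K ≤ μ.restrict S := Measure.restrict_mono hKS le_rfl
  have h1 : eLpNorm (s.indicator (f i)) 1 (μ.restrict K) =
      eLpNorm ((s ∩ K).indicator (f i)) 1 (μ.restrict K) := by
    rw [eLpNorm_indicator_eq_eLpNorm_restrict hs, eLpNorm_indicator_eq_eLpNorm_restrict (hs.inter hK),
      Measure.restrict_restrict hs, Measure.restrict_restrict (hs.inter hK), inter_assoc, inter_self]
  rw [h1]
  refine le_trans (eLpNorm_mono_measure _ hle) (h i (s ∩ K) (hs.inter hK) ?_)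
  calc (μ.restrict S) (s ∩ K) = μ (s ∩ K) := by
        rw [Measure.restrict_apply (hs.inter hK), inter_assoc, inter_eq_self_of_subset_left hKS]
    _ = (μ.restrict K) s := by rw [Measure.restrict_apply hs]
    _ ≤ ENNReal.ofReal δ := hμs

/-- Uniform integrability for a restricted measure passes to restrictions to measurable subsets.
[folklore] -/
theorem uniformIntegrable_restrict_mono {ι : Type*} {f : ι → α → ℝ} {S K : Set α}
    (hf : UniformIntegrable f 1 (μ.restrict S)) (hK : MeasurableSet K) (hKS : K ⊆ S) :
    UniformIntegrable f 1 (μ.restrict K) := by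
  obtain ⟨hm, hU, C, hC⟩ := hf
  have hle : μ.restrict K ≤ μ.restrict S := Measure.restrict_mono hKS le_rfl
  exact ⟨fun i => (hm i).mono_measure hle, unifIntegrable_restrict_mono hU hK hKS, C,
    fun i => (eLpNorm_mono_measure _ hle).trans (hC i)⟩

/-- From `L¹` convergence to a.e. convergence along a subsequence. [folklore] -/
theorem exists_subseq_tendsto_ae_of_tendsto_integral_abs {f : ℕ → α → ℝ} {g : α → ℝ}
    (hf : ∀ n, Integrable (f n) μ) (hg : Integrable g μ)
    (h : Tendsto (fun n => ∫ x, |f n x - g x| ∂μ) atTop (𝓝 0)) :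
    ∃ ns : ℕ → ℕ, StrictMono ns ∧ ∀ᵐ x ∂μ, Tendsto (fun k => f (ns k) x) atTop (𝓝 (g x)) := by
  have hL : Tendsto (fun n => eLpNorm (f n - g) 1 μ) atTop (𝓝 0) := by
    have heq : ∀ n, eLpNorm (f n - g) 1 μ = ENNReal.ofReal (∫ x, |f n x - g x| ∂μ) := by
      intro n
      rw [eLpNorm_one_eq_lintegral_enorm,
        ← ofReal_integral_norm_eq_lintegral_enorm ((hf n).sub hg)]
      rfl
    simp only [heq]
    rw [← ENNReal.ofReal_zero]
    exact ENNReal.tendsto_ofReal h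
  have hm := tendstoInMeasure_of_tendsto_eLpNorm one_ne_zero (fun n => (hf n).1) hg.1 hL
  exact hm.exists_seq_tendsto_ae

end Helpers

end Literature.MathematicalPhysics.KineticTheory

/-! ## Velocity integrals over the slab: Fubini between `(0,T) × E × E` and `(0,T) × E` -/

namespace Literature.MathematicalPhysics.KineticTheory

section Fubini

variable {E : Type*} [NormedAddCommGroup E] [InnerProductSpace ℝ E] [FiniteDimensional ℝ E]
  [MeasurableSpace E] [BorelSpace E]

/-- The regrouping `((t, x), ξ) ↦ (t, x, ξ)` of phase space-time, a measurable equivalence.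
[folklore] -/
def slabAssoc : (ℝ × E) × E ≃ᵐ ℝ × E × E := MeasurableEquiv.prodAssoc

omit [NormedAddCommGroup E] [InnerProductSpace ℝ E] [FiniteDimensional ℝ E] [BorelSpace E] in
/-- Unfolding of `slabAssoc`. [folklore] -/
@[simp]
theorem slabAssoc_apply (p : (ℝ × E) × E) : slabAssoc p = (p.1.1, p.1.2, p.2) := rfl

/-- `slabAssoc` carries `((0,T) × E) × E` with its product Lebesgue measure to the slab measure.
[folklore] -/
theorem measurePreserving_slabAssoc (T : ℝ) :
    MeasurePreserving (slabAssoc (E := E)) ((baseSlabMeasure E T).prod volume) (slabMeasure E T) := by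
  have h := (MeasureTheory.volume_preserving_prodAssoc (α₁ := ℝ) (β₁ := E) (γ₁ := E)).restrict_preimage
    (s := Ioo (0 : ℝ) T ×ˢ (univ : Set (E × E))) (measurableSet_Ioo.prod MeasurableSet.univ)
  have hpre : (MeasurableEquiv.prodAssoc : (ℝ × E) × E ≃ᵐ ℝ × E × E) ⁻¹'
      (Ioo (0 : ℝ) T ×ˢ (univ : Set (E × E))) = (Ioo 0 T ×ˢ univ) ×ˢ univ := by
    ext p
    simp [MeasurableEquiv.prodAssoc]
  rw [hpre] at h
  have hvol : (volume : Measure ((ℝ × E) × E)).restrict ((Ioo 0 T ×ˢ univ) ×ˢ univ) =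
      (baseSlabMeasure E T).prod volume := by
    rw [baseSlabMeasure_def, ← Measure.restrict_univ (μ := (volume : Measure E)),
      Measure.prod_restrict]
    rfl
  rw [hvol] at h
  rw [slabMeasure_def]
  exact h

/-- **Fubini for velocity integrals over the slab**: for `H ∈ L¹((0,T) × E × E)`, the velocity
integral `(t, x) ↦ ∫ H(t, x, ξ) dξ` is integrable on `(0,T) × E`, its `L¹` norm is at most that of
`H`, and its integral is that of `H`. [folklore] -/
theorem integrable_integral_velocity {T : ℝ} {H : ℝ × E × E → ℝ}
    (hH : Integrable H (slabMeasure E T)) :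
    Integrable (fun p : ℝ × E => ∫ ξ, H (p.1, p.2, ξ)) (baseSlabMeasure E T) ∧
    (∫ p : ℝ × E, |(∫ ξ : E, H (p.1, p.2, ξ))| ∂(baseSlabMeasure E T) ≤
      ∫ z, |H z| ∂(slabMeasure E T)) ∧
    ∫ p : ℝ × E, (∫ ξ : E, H (p.1, p.2, ξ)) ∂(baseSlabMeasure E T) = ∫ z, H z ∂(slabMeasure E T) := by
  haveI : SigmaFinite (baseSlabMeasure E T) := by rw [baseSlabMeasure_def]; infer_instance
  have hmp := measurePreserving_slabAssoc (E := E) T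
  have hH' : Integrable (H ∘ slabAssoc) ((baseSlabMeasure E T).prod volume) :=
    (hmp.integrable_comp_emb (slabAssoc (E := E)).measurableEmbedding).2 hH
  have h1 : Integrable (fun p : ℝ × E => ∫ ξ, (H ∘ slabAssoc) (p, ξ)) (baseSlabMeasure E T) :=
    hH'.integral_prod_left
  refine ⟨by simpa using h1, ?_, ?_⟩
  · calc ∫ p : ℝ × E, |(∫ ξ : E, H (p.1, p.2, ξ))| ∂(baseSlabMeasure E T)
        ≤ ∫ p : ℝ × E, (∫ ξ : E, |H (p.1, p.2, ξ)|) ∂(baseSlabMeasure E T) := by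
          refine integral_mono_of_nonneg (ae_of_all _ fun p => abs_nonneg _) ?_
            (ae_of_all _ fun p => ?_)
          · simpa using hH'.norm.integral_prod_left
          · have := norm_integral_le_integral_norm (fun ξ => H (p.1, p.2, ξ)) (μ := volume)
            simpa only [Real.norm_eq_abs] using this
      _ = ∫ q, |(H ∘ slabAssoc) q| ∂((baseSlabMeasure E T).prod volume) := by
          rw [integral_prod _ hH'.abs]; rfl
      _ = ∫ z, |H z| ∂(slabMeasure E T) :=
          hmp.integral_comp (slabAssoc (E := E)).measurableEmbedding (fun z => |H z|)
  · calc ∫ p : ℝ × E, (∫ ξ : E, H (p.1, p.2, ξ)) ∂(baseSlabMeasure E T)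
        = ∫ q, (H ∘ slabAssoc) q ∂((baseSlabMeasure E T).prod volume) := by
          rw [integral_prod _ hH']; rfl
      _ = ∫ z, H z ∂(slabMeasure E T) :=
          hmp.integral_comp (slabAssoc (E := E)).measurableEmbedding H

/-- A function of `(t, x)` which is a.e. strongly measurable on `(0,T) × E` lifts to an a.e. strongly
measurable function on the slab. [folklore] -/
theorem aestronglyMeasurable_comp_base {T : ℝ} {φ : ℝ × E → ℝ}
    (hφ : AEStronglyMeasurable φ (baseSlabMeasure E T)) :
    AEStronglyMeasurable (fun z : ℝ × E × E => φ (z.1, z.2.1)) (slabMeasure E T) := by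
  haveI : SigmaFinite (baseSlabMeasure E T) := by rw [baseSlabMeasure_def]; infer_instance
  have hmp := measurePreserving_slabAssoc (E := E) T
  have h1 : AEStronglyMeasurable (fun q : (ℝ × E) × E => φ q.1) ((baseSlabMeasure E T).prod volume) :=
    hφ.comp_quasiMeasurePreserving (Measure.quasiMeasurePreserving_fst (μ := baseSlabMeasure E T)
      (ν := (volume : Measure E)))
  have h2 := h1.comp_quasiMeasurePreserving (hmp.symm _).quasiMeasurePreserving
  refine h2.congr (ae_of_all _ fun z => ?_)
  simp [slabAssoc, MeasurableEquiv.prodAssoc]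

/-- An almost-everywhere property on `(0,T) × E` lifts to the slab. [folklore] -/
theorem ae_comp_base {T : ℝ} {p : ℝ × E → Prop} (h : ∀ᵐ q ∂(baseSlabMeasure E T), p q) :
    ∀ᵐ z ∂(slabMeasure E T), p (z.1, z.2.1) := by
  haveI : SigmaFinite (baseSlabMeasure E T) := by rw [baseSlabMeasure_def]; infer_instance
  have hmp := measurePreserving_slabAssoc (E := E) T
  have h1 : ∀ᵐ q ∂((baseSlabMeasure E T).prod volume), p q.1 :=
    (Measure.quasiMeasurePreserving_fst (μ := baseSlabMeasure E T) (ν := (volume : Measure E))).ae h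
  have h2 := (hmp.symm _).quasiMeasurePreserving.ae h1
  refine h2.mono fun z hz => ?_
  simpa [slabAssoc, MeasurableEquiv.prodAssoc] using hz

/-- Testing a velocity integral against a bounded function of `(t, x)` is testing the integrand
against the same function lifted to phase space-time. [folklore] -/
theorem integral_integral_velocity_mul {T : ℝ} {H : ℝ × E × E → ℝ}
    (hH : Integrable H (slabMeasure E T)) {φ : ℝ × E → ℝ} {C : ℝ}
    (hφ : AEStronglyMeasurable φ (baseSlabMeasure E T)) (hC : ∀ᵐ p ∂(baseSlabMeasure E T), |φ p| ≤ C) :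
    ∫ p : ℝ × E, (∫ ξ : E, H (p.1, p.2, ξ)) * φ p ∂(baseSlabMeasure E T) =
      ∫ z, H z * φ (z.1, z.2.1) ∂(slabMeasure E T) := by
  have hφ' := aestronglyMeasurable_comp_base hφ
  have hC' : ∀ᵐ z ∂(slabMeasure E T), |φ (z.1, z.2.1)| ≤ C := ae_comp_base hC
  have hC0 : ∀ᵐ z ∂(slabMeasure E T), ‖φ (z.1, z.2.1)‖ ≤ max C 0 :=
    hC'.mono fun z hz => (Real.norm_eq_abs _).le.trans (hz.trans (le_max_left _ _))
  have hHφ : Integrable (fun z : ℝ × E × E => H z * φ (z.1, z.2.1)) (slabMeasure E T) :=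
    hH.mul_bdd hφ' hC0
  rw [← (integrable_integral_velocity hHφ).2.2]
  refine integral_congr_ae (ae_of_all _ fun p => ?_)
  simp only
  rw [← integral_mul_const]

end Fubini

end Literature.MathematicalPhysics.KineticTheory

/-! ## From the equation along characteristics to the transport equation in `𝒟'` -/

namespace Literature.MathematicalPhysics.KineticTheory

section Transport

variable {E : Type*} [NormedAddCommGroup E] [InnerProductSpace ℝ E] [FiniteDimensional ℝ E]
  [MeasurableSpace E] [BorelSpace E]

omit [FiniteDimensional ℝ E] [MeasurableSpace E] [BorelSpace E] in
/-- The transport derivative of a test function is supported in the support of the test function.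
[folklore] -/
theorem tsupport_transportDeriv_subset (φ : ℝ × E × E → ℝ) :
    tsupport (transportDeriv φ) ⊆ tsupport φ := by
  refine (closure_mono ?_).trans (tsupport_fderiv_subset ℝ (f := φ))
  intro z hz
  rw [Function.mem_support] at hz ⊢
  intro h
  apply hz
  simp [transportDeriv, h]

omit [FiniteDimensional ℝ E] [MeasurableSpace E] [BorelSpace E] in
/-- The transport derivative of a `C¹` function is continuous. [folklore] -/
theorem continuous_transportDeriv {φ : ℝ × E × E → ℝ} {n : WithTop ℕ∞}
    (hφ : ContDiff ℝ n φ) (hn : n ≠ 0) : Continuous (transportDeriv φ) := by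
  unfold transportDeriv
  exact (hφ.continuous_fderiv hn).clm_apply (by fun_prop)

omit [InnerProductSpace ℝ E] [FiniteDimensional ℝ E] [MeasurableSpace E] [BorelSpace E] in
/-- Time bounds for a compact subset of an open time slab: `K ⊆ (0,T) × E × E` compact lies in
`(a, b) × E × E` for some `0 < a`, `b < T`, `a ≤ b`. [folklore] -/
theorem exists_time_bounds_of_isCompact {T : ℝ} {K : Set (ℝ × E × E)} (hK : IsCompact K)
    (hKS : K ⊆ Ioo 0 T ×ˢ univ) (hne : K.Nonempty) :
    ∃ a b : ℝ, 0 < a ∧ a ≤ b ∧ b < T ∧ ∀ z ∈ K, a < z.1 ∧ z.1 < b := by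
  obtain ⟨p₀, hp₀, hmin⟩ := hK.exists_isMinOn hne continuous_fst.continuousOn
  obtain ⟨p₁, hp₁, hmax⟩ := hK.exists_isMaxOn hne continuous_fst.continuousOn
  have h0 : 0 < p₀.1 := (mem_prod.1 (hKS hp₀)).1.1
  have h1 : p₁.1 < T := (mem_prod.1 (hKS hp₁)).1.2
  have h01 : p₀.1 ≤ p₁.1 := hmin hp₁
  refine ⟨p₀.1 / 2, (p₁.1 + T) / 2, by linarith, by linarith, by linarith, fun z hz => ⟨?_, ?_⟩⟩
  · have h' : p₀.1 ≤ z.1 := hmin hz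
    linarith
  · have h' : z.1 ≤ p₁.1 := hmax hz
    linarith

/-- A locally integrable function on the open slab times a continuous function supported in a
compact subset of the slab is integrable. [folklore] -/
theorem integrable_mul_of_tsupport_subset {T : ℝ} {u : ℝ × E × E → ℝ}
    (hu : LocallyIntegrableOn u (Ioo 0 T ×ˢ univ) volume) {ψ : ℝ × E × E → ℝ} (hψ : Continuous ψ)
    {K : Set (ℝ × E × E)} (hK : IsCompact K) (hKS : K ⊆ Ioo 0 T ×ˢ univ) (hψK : tsupport ψ ⊆ K) :
    Integrable (fun z => u z * ψ z) volume := by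
  have huK : IntegrableOn u K volume := hu.integrableOn_compact_subset hKS hK
  obtain ⟨C, hC⟩ := (hK.image hψ).isBounded.exists_norm_le
  have hK' : IntegrableOn (fun z => u z * ψ z) K volume := by
    refine Integrable.mul_bdd (c := C) huK hψ.aestronglyMeasurable ?_
    filter_upwards [ae_restrict_mem hK.measurableSet] with z hz
    exact hC _ (mem_image_of_mem _ hz)
  refine hK'.integrable_of_forall_notMem_eq_zero fun z hz => ?_
  have : ψ z = 0 := image_eq_zero_of_notMem_tsupport fun h => hz (hψK h)
  simp [this]

/-- **The transport equation in `𝒟'` from the equation along characteristics** (the easy half of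
CIP 1994 Thm 5.A.1, p. 164, for functions differentiable along characteristics): if `u, h` are
locally integrable on `(0,T) × E × E` and, along every characteristic, `s ↦ u(s, x + s v, v)` is
differentiable on `(0,T)` with continuous derivative `s ↦ h(s, x + s v, v)`, then
`(∂ₜ + v·∇ₓ) u = h` in `𝒟'((0,T) × E × E)` (`HasDistribTransportOn`). Proof: pass to free-flow
coordinates (a measure-preserving shear) and integrate by parts in time along each
characteristic. [cite: CIPDiluteGases1994, Appendix 5.A Thm 5.A.1 (p. 164)] -/
theorem hasDistribTransportOn_of_hasDerivAt_characteristics {T : ℝ} {u h : ℝ × E × E → ℝ}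
    (hu : LocallyIntegrableOn u (Ioo 0 T ×ˢ univ) volume)
    (hh : LocallyIntegrableOn h (Ioo 0 T ×ˢ univ) volume)
    (hderiv : ∀ x v : E, ∀ s ∈ Ioo 0 T,
      HasDerivAt (fun σ => u (σ, x + σ • v, v)) (h (s, x + s • v, v)) s)
    (hcont : ∀ x v : E, ContinuousOn (fun s => h (s, x + s • v, v)) (Ioo 0 T)) :
    HasDistribTransportOn (Ioo 0 T) u h := by
  refine ⟨hu, hh, fun φ hφ hφc hφS => ?_⟩
  set K := tsupport φ with hKdef
  have hK : IsCompact K := hφc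
  -- the empty case
  rcases K.eq_empty_or_nonempty with hKe | hKne
  · have hφ0 : φ = 0 := (tsupport_eq_empty_iff).1 hKe
    have hT0 : transportDeriv φ = 0 := by
      funext z; simp [transportDeriv, hφ0]
    rw [hT0, hφ0]
    simp
  obtain ⟨a, b, ha, hab, hbT, hKab⟩ := exists_time_bounds_of_isCompact hK hφS hKne
  -- the two integrands and their integrability
  have hφcont : Continuous φ := hφ.continuous
  have hTφcont : Continuous (transportDeriv φ) := continuous_transportDeriv hφ (by simp)
  have hG₁ : Integrable (fun z => u z * transportDeriv φ z) volume :=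
    integrable_mul_of_tsupport_subset hu hTφcont hK hφS (tsupport_transportDeriv_subset φ)
  have hG₂ : Integrable (fun z => h z * φ z) volume :=
    integrable_mul_of_tsupport_subset hh hφcont hK hφS subset_rfl
  -- both integrands vanish off `(0,∞) × E × E`
  have hKpos : ∀ z, z ∉ Ioi (0 : ℝ) ×ˢ (univ : Set (E × E)) → z ∉ K := by
    intro z hz hzK
    exact hz ⟨mem_Ioi.2 (ha.trans (hKab z hzK).1), mem_univ _⟩
  have hvan₁ : ∀ z, z ∉ Ioi (0 : ℝ) ×ˢ (univ : Set (E × E)) → u z * transportDeriv φ z = 0 := by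
    intro z hz
    have : transportDeriv φ z = 0 :=
      image_eq_zero_of_notMem_tsupport fun h => hKpos z hz (tsupport_transportDeriv_subset φ h)
    simp [this]
  have hvan₂ : ∀ z, z ∉ Ioi (0 : ℝ) ×ˢ (univ : Set (E × E)) → h z * φ z = 0 := by
    intro z hz
    have : φ z = 0 := image_eq_zero_of_notMem_tsupport (hKpos z hz)
    simp [this]
  have hI₁ : ∫ z, u z * transportDeriv φ z =
      ∫ z, u z * transportDeriv φ z ∂(volume.restrict (Ioi 0 ×ˢ univ)) :=
    (setIntegral_eq_integral_of_forall_compl_eq_zero fun z hz => hvan₁ z hz).symm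
  have hI₂ : ∫ z, h z * φ z = ∫ z, h z * φ z ∂(volume.restrict (Ioi 0 ×ˢ univ)) :=
    (setIntegral_eq_integral_of_forall_compl_eq_zero fun z hz => hvan₂ z hz).symm
  rw [hI₁, hI₂, integral_eq_integral_integral_shearFlow hG₁.restrict,
    integral_eq_integral_integral_shearFlow hG₂.restrict, ← integral_neg]
  refine integral_congr_ae (ae_of_all _ fun zz => ?_)
  -- along the characteristic through `zz = (x, v)`
  obtain ⟨x, v⟩ := zz
  simp only [shearFlow_apply]
  set U : ℝ → ℝ := fun s => u (s, x + s • v, v) with hU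
  set Hs : ℝ → ℝ := fun s => h (s, x + s • v, v) with hHs
  set ρ : ℝ → ℝ := fun s => φ (s, x + s • v, v) with hρ
  set ρ' : ℝ → ℝ := fun s => transportDeriv φ (s, x + s • v, v) with hρ'
  -- vanishing of `ρ`, `ρ'` outside `(a, b)`
  have hρvan : ∀ s, s ∉ Ioo a b → ρ s = 0 ∧ ρ' s = 0 := by
    intro s hs
    have hnot : ((s, x + s • v, v) : ℝ × E × E) ∉ K := fun hz => hs (hKab _ hz)
    exact ⟨image_eq_zero_of_notMem_tsupport (f := φ) hnot,
      image_eq_zero_of_notMem_tsupport (f := transportDeriv φ)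
        fun h => hnot (tsupport_transportDeriv_subset φ h)⟩
  -- derivatives
  have hρd : ∀ s, HasDerivAt ρ (ρ' s) s := fun s =>
    hasDerivAt_comp_characteristic (hφ.differentiable (by simp)) x v s
  have hUd : ∀ s ∈ uIcc a b, HasDerivAt U (Hs s) s := by
    intro s hs
    rw [uIcc_of_le hab] at hs
    exact hderiv x v s ⟨ha.trans_le hs.1, hs.2.trans_lt hbT⟩
  have hHsi : IntervalIntegrable Hs volume a b := by
    refine ContinuousOn.intervalIntegrable_of_Icc hab ?_
    exact (hcont x v).mono fun s hs => ⟨ha.trans_le hs.1, hs.2.trans_lt hbT⟩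
  have hρ'i : IntervalIntegrable ρ' volume a b :=
    (hTφcont.comp (by fun_prop : Continuous fun s : ℝ => ((s, x + s • v, v) : ℝ × E × E))).intervalIntegrable _ _
  have hparts := intervalIntegral.integral_mul_deriv_eq_deriv_mul hUd (fun s _ => hρd s) hHsi hρ'i
  have hρa : ρ a = 0 := (hρvan a fun h => lt_irrefl _ h.1).1
  have hρb : ρ b = 0 := (hρvan b fun h => lt_irrefl _ h.2).1
  rw [hρa, hρb, mul_zero, mul_zero, sub_zero, zero_sub] at hparts
  -- from `(0, ∞)` to `[a, b]`
  have hIoc : Ioc a b ⊆ Ioi (0 : ℝ) := fun s hs => ha.trans hs.1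
  have h1 : ∫ s in Ioi (0 : ℝ), U s * ρ' s = ∫ s in a..b, U s * ρ' s := by
    rw [intervalIntegral.integral_of_le hab]
    refine setIntegral_eq_of_subset_of_forall_sdiff_eq_zero measurableSet_Ioi hIoc fun s hs => ?_
    have : s ∉ Ioo a b := fun h' => hs.2 ⟨h'.1, h'.2.le⟩
    simp [(hρvan s this).2]
  have h2 : ∫ s in Ioi (0 : ℝ), Hs s * ρ s = ∫ s in a..b, Hs s * ρ s := by
    rw [intervalIntegral.integral_of_le hab]
    refine (setIntegral_eq_of_subset_of_forall_sdiff_eq_zero measurableSet_Ioi hIoc fun s hs => ?_)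
    have : s ∉ Ioo a b := fun h' => hs.2 ⟨h'.1, h'.2.le⟩
    simp [(hρvan s this).1]
  change ∫ s in Ioi (0 : ℝ), U s * ρ' s = -∫ s in Ioi (0 : ℝ), Hs s * ρ s
  rw [h1, h2, hparts]

end Transport

end Literature.MathematicalPhysics.KineticTheory

/-! ## The renormalised approximate solutions solve a transport equation in `𝒟'` -/

namespace Literature.MathematicalPhysics.KineticTheory

open Literature.Analysis.FluidPDE

section Renormalised

variable {E : Type*} [NormedAddCommGroup E] [InnerProductSpace ℝ E] [FiniteDimensional ℝ E]
  [MeasurableSpace E] [BorelSpace E]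

/-- The normalised, weighted gain term `G = (1 + δ ∫ |f| dv)⁻¹ Q⁺_B(f,f)/(1 + f)` of CIP 1994
Lemma 5.3.7, as a function on phase space-time (the family of
`diPernaLions_approx_collisionTerms_weaklyCompact`). [cite: CIPDiluteGases1994, §5.3 Lemma 5.3.7 (p. 148)] -/
def normGain (δ : ℝ) (B : E × E → sphere (0 : E) 1 → ℝ) (f : ℝ → E → E → ℝ) (z : ℝ × E × E) : ℝ :=
  (1 + δ * ∫ w, |f z.1 z.2.1 w|)⁻¹ * gainWith B (f z.1 z.2.1) (f z.1 z.2.1) z.2.2 / (1 + f z.1 z.2.1 z.2.2)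

/-- The normalised, weighted loss term `L = (1 + δ ∫ |f| dv)⁻¹ Q⁻_B(f,f)/(1 + f)` of CIP 1994
Lemma 5.3.7, as a function on phase space-time. [cite: CIPDiluteGases1994, §5.3 Lemma 5.3.7 (p. 148)] -/
def normLoss (δ : ℝ) (B : E × E → sphere (0 : E) 1 → ℝ) (f : ℝ → E → E → ℝ) (z : ℝ × E × E) : ℝ :=
  (1 + δ * ∫ w, |f z.1 z.2.1 w|)⁻¹ * lossWith B (f z.1 z.2.1) (f z.1 z.2.1) z.2.2 / (1 + f z.1 z.2.1 z.2.2)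

/-- The renormalised collision term `β_κ'(f) Q̃_δ(f,f) = (1 + κ f)⁻¹ (1 + δ ∫ f dv)⁻¹ Q_B(f,f)`
(CIP 1994 §5.3 Step 10 / Lemma 5.3.10 with `β_δ(s) = δ⁻¹ ln (1 + δ s)`: `T β_δ(fⁿ) = β_δ'(fⁿ) T fⁿ`),
written through the normalised weighted gain and loss terms as `(1 + f)(1 + κ f)⁻¹ (G - L)`. [cite: CIPDiluteGases1994, §5.3 Lemma 5.3.10 (p. 155)] -/
def renormCollision (κ δ : ℝ) (B : E × E → sphere (0 : E) 1 → ℝ) (f : ℝ → E → E → ℝ)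
    (z : ℝ × E × E) : ℝ :=
  (1 + f z.1 z.2.1 z.2.2) / (1 + κ * f z.1 z.2.1 z.2.2) * (normGain δ B f z - normLoss δ B f z)

/-- Unfolding of `normGain`. [folklore] -/
theorem normGain_apply (δ : ℝ) (B : E × E → sphere (0 : E) 1 → ℝ) (f : ℝ → E → E → ℝ) (z : ℝ × E × E) :
    normGain δ B f z = (1 + δ * ∫ w, |f z.1 z.2.1 w|)⁻¹ *
      gainWith B (f z.1 z.2.1) (f z.1 z.2.1) z.2.2 / (1 + f z.1 z.2.1 z.2.2) := rfl

/-- Unfolding of `normLoss`. [folklore] -/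
theorem normLoss_apply (δ : ℝ) (B : E × E → sphere (0 : E) 1 → ℝ) (f : ℝ → E → E → ℝ) (z : ℝ × E × E) :
    normLoss δ B f z = (1 + δ * ∫ w, |f z.1 z.2.1 w|)⁻¹ *
      lossWith B (f z.1 z.2.1) (f z.1 z.2.1) z.2.2 / (1 + f z.1 z.2.1 z.2.2) := rfl

/-- The elementary bound `(1 + y)/(1 + κ y) ≤ κ⁻¹` for `0 < κ ≤ 1`, `y ≥ 0`. [folklore] -/
theorem one_add_div_one_add_mul_le {κ y : ℝ} (hκ : 0 < κ) (hκ1 : κ ≤ 1) (hy : 0 ≤ y) :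
    (1 + y) / (1 + κ * y) ≤ κ⁻¹ := by
  rw [div_le_iff₀ (by nlinarith), le_inv_mul_iff₀' hκ]
  nlinarith

/-- Pointwise bound of the renormalised collision term by the normalised weighted gain and loss
terms: `|β_κ'(f) Q̃(f,f)| ≤ κ⁻¹ (|G| + |L|)` wherever `f ≥ 0`, for `0 < κ ≤ 1`. [folklore] -/
theorem abs_renormCollision_le {κ δ : ℝ} {B : E × E → sphere (0 : E) 1 → ℝ} {f : ℝ → E → E → ℝ}
    (hκ : 0 < κ) (hκ1 : κ ≤ 1) {z : ℝ × E × E} (hz : 0 ≤ f z.1 z.2.1 z.2.2) :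
    |renormCollision κ δ B f z| ≤ κ⁻¹ * (|normGain δ B f z| + |normLoss δ B f z|) := by
  unfold renormCollision
  rw [abs_mul, abs_of_nonneg (div_nonneg (by linarith) (by nlinarith))]
  exact mul_le_mul (one_add_div_one_add_mul_le hκ hκ1 hz) (abs_sub _ _) (abs_nonneg _)
    (inv_nonneg.2 hκ.le)

/-- **The renormalised equation along characteristics** for an approximate solution: for `s > 0`,
`d/ds β_κ(f)(s, x + s v, v) = (β_κ'(f) Q̃_δ(f,f))(s, x + s v, v)` (`renormCollision`), the kernel being
bounded and vanishing for large relative velocities (so that the collision integrals converge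
absolutely and `Q = Q⁺ - Q⁻`). [cite: CIPDiluteGases1994, §5.3 Step 10 (p. 151)] -/
theorem IsDiPernaLionsApproximateSolution.hasDerivAt_logTrunc_sharp {δ : ℝ}
    {B : E × E → sphere (0 : E) 1 → ℝ} {f : ℝ → E → E → ℝ}
    (hf : IsDiPernaLionsApproximateSolution δ B f) (hδ : 0 ≤ δ)
    (hBk : KineticTheory.IsDiPernaLionsKernel B) {Cb : ℝ} (hCb : ∀ p ω, B p ω ≤ Cb) {Rb : ℝ}
    (hRb : ∀ (z : E) ω, Rb ≤ ‖z‖ → B (z, 0) ω = 0) {κ : ℝ} (hκ : 0 < κ) {s : ℝ} (hs : 0 < s)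
    (x v : E) :
    HasDerivAt (fun σ => logTrunc κ (f σ (x + σ • v) v))
      (renormCollision κ δ B f (s, x + s • v, v)) s ∧
    renormCollision κ δ B f (s, x + s • v, v) =
      (1 + κ * f s (x + s • v) v)⁻¹ * truncatedCollisionOp δ B (f s (x + s • v)) v := by
  obtain ⟨hD, hDeq⟩ := hf.hasDerivAt_sharp hs x v
  set D : ℝ := fderiv ℝ (fun z : ℝ × E × E => f z.1 z.2.1 z.2.2) (s, x + s • v, v) ((1 : ℝ), v, (0 : E))
  have hu0 : 0 ≤ f s (x + s • v) v := hf.nonneg s hs.le _ _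
  have hpos : 0 < 1 + κ * f s (x + s • v) v := by nlinarith
  -- `Q = Q⁺ - Q⁻` at this point
  obtain ⟨hc, ⟨K, hK⟩, hi⟩ := hf.slice_velocity hs.le (x + s • v)
  obtain ⟨hgi, hli⟩ := gain_loss_integrable_of_bounded_kernel hBk hCb hRb hc hK hi v
  have hQ := collisionOpWith_eq_gainWith_sub_lossWith_holds B (f s (x + s • v)) (f s (x + s • v)) v hgi hli
  -- the identity `renormCollision = (1 + κ f)⁻¹ Q̃`
  have hid : renormCollision κ δ B f (s, x + s • v, v) =
      (1 + κ * f s (x + s • v) v)⁻¹ * truncatedCollisionOp δ B (f s (x + s • v)) v := by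
    simp only [renormCollision, normGain, normLoss, truncatedCollisionOp, hQ]
    have h1 : (1 + f s (x + s • v) v) ≠ 0 := by linarith
    field_simp
  refine ⟨?_, hid⟩
  rw [hid, ← hDeq]
  have h2 : HasDerivAt (fun σ => 1 + κ * f σ (x + σ • v) v) (κ * D) s := by
    simpa using (hD.const_mul κ).const_add 1
  have h3 := (h2.log hpos.ne').const_mul κ⁻¹
  refine h3.congr_deriv ?_
  field_simp

/-- The renormalised collision term of an approximate solution is continuous along characteristics
for positive times. [folklore] -/
theorem IsDiPernaLionsApproximateSolution.continuousOn_renormCollision_sharp {δ : ℝ}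
    {B : E × E → sphere (0 : E) 1 → ℝ} {f : ℝ → E → E → ℝ}
    (hf : IsDiPernaLionsApproximateSolution δ B f) (hδ : 0 ≤ δ)
    (hBk : KineticTheory.IsDiPernaLionsKernel B) {Cb : ℝ} (hCb : ∀ p ω, B p ω ≤ Cb) {Rb : ℝ}
    (hRb : ∀ (z : E) ω, Rb ≤ ‖z‖ → B (z, 0) ω = 0) {κ : ℝ} (hκ : 0 < κ) (x v : E) :
    ContinuousOn (fun s => renormCollision κ δ B f (s, x + s • v, v)) (Ioi 0) := by
  have hD := hf.continuousOn_fderiv_sharp x v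
  have hu : ContinuousOn (fun σ : ℝ => f σ (x + σ • v) v) (Ioi 0) :=
    (hf.continuousOn_sharp x v).mono Ioi_subset_Ici_self
  have hinv : ContinuousOn (fun σ : ℝ => (1 + κ * f σ (x + σ • v) v)⁻¹) (Ioi 0) := by
    refine ContinuousOn.inv₀ (continuousOn_const.add (continuousOn_const.mul hu)) fun σ hσ => ?_
    nlinarith [hf.nonneg σ (le_of_lt hσ) (x + σ • v) v]
  refine (hinv.mul hD).congr fun s hs => ?_
  rw [(hf.hasDerivAt_logTrunc_sharp hδ hBk hCb hRb hκ hs x v).2, Pi.mul_apply,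
    (hf.hasDerivAt_sharp hs x v).2]

/-- `β_κ(f)` is continuous on `[0, ∞) × E × E` for an approximate solution. [folklore] -/
theorem IsDiPernaLionsApproximateSolution.continuousOn_logTrunc {δ : ℝ}
    {B : E × E → sphere (0 : E) 1 → ℝ} {f : ℝ → E → E → ℝ}
    (hf : IsDiPernaLionsApproximateSolution δ B f) {κ : ℝ} (hκ : 0 < κ) :
    ContinuousOn (fun z : ℝ × E × E => logTrunc κ (f z.1 z.2.1 z.2.2)) (Ici 0 ×ˢ univ) := by
  refine ContinuousOn.comp' (g := logTrunc κ) (t := Ici 0) ?_ hf.continuousOn_uncurry ?_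
  · exact fun y hy => (continuousAt_logTrunc hκ hy).continuousWithinAt
  · rintro ⟨t, x, v⟩ hz
    exact hf.nonneg t (mem_prod.1 hz).1 x v

/-- `β_κ(f)` is locally integrable on every open slab `(0,T) × E × E`. [folklore] -/
theorem IsDiPernaLionsApproximateSolution.locallyIntegrableOn_logTrunc {δ : ℝ}
    {B : E × E → sphere (0 : E) 1 → ℝ} {f : ℝ → E → E → ℝ}
    (hf : IsDiPernaLionsApproximateSolution δ B f) {κ : ℝ} (hκ : 0 < κ) (T : ℝ) :
    LocallyIntegrableOn (fun z : ℝ × E × E => logTrunc κ (f z.1 z.2.1 z.2.2)) (Ioo 0 T ×ˢ univ) volume :=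
  ((hf.continuousOn_logTrunc hκ).mono (prod_mono (fun _ ht => le_of_lt ht.1) Subset.rfl)).locallyIntegrableOn
    (measurableSet_Ioo.prod MeasurableSet.univ)

/-- The renormalised collision term agrees on `{t > 0}` with a globally measurable function (its
composition with the time clamp `max t 0`). [folklore] -/
theorem IsDiPernaLionsApproximateSolution.exists_measurable_eq_renormCollision {δ : ℝ}
    {B : E × E → sphere (0 : E) 1 → ℝ} {f : ℝ → E → E → ℝ}
    (hf : IsDiPernaLionsApproximateSolution δ B f) (hBm : Measurable (Function.uncurry B)) (κ : ℝ) :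
    ∃ H : ℝ × E × E → ℝ, Measurable H ∧ ∀ z : ℝ × E × E, 0 < z.1 → H z = renormCollision κ δ B f z := by
  obtain ⟨hG, hL⟩ := hf.measurable_gain_loss_terms_clamp hBm δ
  have hfc : Measurable fun q : ℝ × E × E => f (max q.1 0) q.2.1 q.2.2 :=
    (hf.continuous_clamp continuous_fst (continuous_fst.comp continuous_snd)
      (continuous_snd.comp continuous_snd)).measurable
  refine ⟨fun q => (1 + f (max q.1 0) q.2.1 q.2.2) / (1 + κ * f (max q.1 0) q.2.1 q.2.2) *
    ((1 + δ * ∫ w, |f (max q.1 0) q.2.1 w|)⁻¹ *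
        gainWith B (f (max q.1 0) q.2.1) (f (max q.1 0) q.2.1) q.2.2 / (1 + f (max q.1 0) q.2.1 q.2.2) -
      (1 + δ * ∫ w, |f (max q.1 0) q.2.1 w|)⁻¹ *
        lossWith B (f (max q.1 0) q.2.1) (f (max q.1 0) q.2.1) q.2.2 / (1 + f (max q.1 0) q.2.1 q.2.2)),
    ((measurable_const.add hfc).div (measurable_const.add (measurable_const.mul hfc))).mul (hG.sub hL),
    fun z hz => ?_⟩
  simp only [renormCollision, normGain, normLoss, max_eq_left hz.le]

/-- The renormalised collision term of an approximate solution is integrable on every box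
`(0,T) × E × B̄_R` on which the normalised weighted gain and loss terms are, with the bound
`κ⁻¹ (|G| + |L|)`. [folklore] -/
theorem IsDiPernaLionsApproximateSolution.integrableOn_renormCollision_box {δ : ℝ}
    {B : E × E → sphere (0 : E) 1 → ℝ} {f : ℝ → E → E → ℝ}
    (hf : IsDiPernaLionsApproximateSolution δ B f) (hBm : Measurable (Function.uncurry B))
    {κ : ℝ} (hκ : 0 < κ) (hκ1 : κ ≤ 1) {T R : ℝ}
    (hG : IntegrableOn (normGain δ B f) (Ioo 0 T ×ˢ (univ ×ˢ closedBall (0 : E) R)) volume)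
    (hL : IntegrableOn (normLoss δ B f) (Ioo 0 T ×ˢ (univ ×ˢ closedBall (0 : E) R)) volume) :
    IntegrableOn (renormCollision κ δ B f) (Ioo 0 T ×ˢ (univ ×ˢ closedBall (0 : E) R)) volume := by
  have hbox : MeasurableSet (Ioo 0 T ×ˢ ((univ : Set E) ×ˢ closedBall (0 : E) R)) :=
    measurableSet_Ioo.prod (MeasurableSet.univ.prod measurableSet_closedBall)
  obtain ⟨H, hHm, hH⟩ := hf.exists_measurable_eq_renormCollision hBm κ
  have hmeas : AEStronglyMeasurable (renormCollision κ δ B f)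
      (volume.restrict (Ioo 0 T ×ˢ ((univ : Set E) ×ˢ closedBall (0 : E) R))) := by
    refine hHm.aestronglyMeasurable.congr ?_
    filter_upwards [ae_restrict_mem hbox] with z hz
    exact hH z (mem_prod.1 hz).1.1
  refine Integrable.mono' ((hG.abs.add hL.abs).const_mul κ⁻¹) hmeas ?_
  filter_upwards [ae_restrict_mem hbox] with z hz
  rw [Real.norm_eq_abs]
  exact abs_renormCollision_le hκ hκ1 (hf.nonneg z.1 (mem_prod.1 hz).1.1.le _ _)

/-- The renormalised collision term is locally integrable on the open slab `(0,T) × E × E` once the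
normalised weighted gain and loss terms are integrable on all boxes `(0,T) × E × B̄_R`. [folklore] -/
theorem IsDiPernaLionsApproximateSolution.locallyIntegrableOn_renormCollision {δ : ℝ}
    {B : E × E → sphere (0 : E) 1 → ℝ} {f : ℝ → E → E → ℝ}
    (hf : IsDiPernaLionsApproximateSolution δ B f) (hBm : Measurable (Function.uncurry B))
    {κ : ℝ} (hκ : 0 < κ) (hκ1 : κ ≤ 1) {T : ℝ}
    (hGL : ∀ R : ℝ, IntegrableOn (normGain δ B f) (Ioo 0 T ×ˢ (univ ×ˢ closedBall (0 : E) R)) volume ∧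
      IntegrableOn (normLoss δ B f) (Ioo 0 T ×ˢ (univ ×ˢ closedBall (0 : E) R)) volume) :
    LocallyIntegrableOn (renormCollision κ δ B f) (Ioo 0 T ×ˢ univ) volume := by
  intro z hz
  refine ⟨Ioo 0 T ×ˢ (univ ×ˢ ball z.2.2 1), ?_, ?_⟩
  · refine mem_nhdsWithin_of_mem_nhds ((isOpen_Ioo.prod (isOpen_univ.prod isOpen_ball)).mem_nhds ?_)
    exact ⟨(mem_prod.1 hz).1, mem_univ _, mem_ball_self one_pos⟩
  · refine (hf.integrableOn_renormCollision_box hBm hκ hκ1 (hGL (‖z.2.2‖ + 1)).1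
      (hGL (‖z.2.2‖ + 1)).2).mono_set (prod_mono Subset.rfl (prod_mono Subset.rfl ?_))
    intro w hw
    rw [mem_closedBall, dist_zero_right]
    have := mem_ball_iff_norm.1 hw
    calc ‖w‖ = ‖(w - z.2.2) + z.2.2‖ := by rw [sub_add_cancel]
      _ ≤ ‖w - z.2.2‖ + ‖z.2.2‖ := norm_add_le _ _
      _ ≤ ‖z.2.2‖ + 1 := by linarith [this.le]

/-- **The renormalised approximate solutions solve `T β_κ(fⁿ) = β_κ'(fⁿ) Q̃ₙ(fⁿ,fⁿ)` in
`𝒟'((0,T) × E × E)`** (CIP 1994 §5.3 Lemma 5.3.10 (ii) / proof of Lemma 5.3.11, p. 155: "apply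
Lemma 5.3.10 with `β_δ(s) = δ⁻¹ ln(1 + δ s)`"; the hypothesis "`{T(β_δ(fⁿ))}` weakly relatively
compact in `L¹_loc`" refers to this identity). For an approximate solution with a bounded kernel
vanishing for large relative velocities, `0 < κ ≤ 1`, and normalised weighted collision terms
integrable on boxes. [cite: CIPDiluteGases1994, §5.3 Lemma 5.3.10–5.3.11 (p. 155)] -/
theorem IsDiPernaLionsApproximateSolution.hasDistribTransportOn_logTrunc {δ : ℝ}
    {B : E × E → sphere (0 : E) 1 → ℝ} {f : ℝ → E → E → ℝ}
    (hf : IsDiPernaLionsApproximateSolution δ B f) (hδ : 0 ≤ δ)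
    (hBk : KineticTheory.IsDiPernaLionsKernel B) {Cb : ℝ} (hCb : ∀ p ω, B p ω ≤ Cb) {Rb : ℝ}
    (hRb : ∀ (z : E) ω, Rb ≤ ‖z‖ → B (z, 0) ω = 0) {κ : ℝ} (hκ : 0 < κ) (hκ1 : κ ≤ 1) {T : ℝ}
    (hGL : ∀ R : ℝ, IntegrableOn (normGain δ B f) (Ioo 0 T ×ˢ (univ ×ˢ closedBall (0 : E) R)) volume ∧
      IntegrableOn (normLoss δ B f) (Ioo 0 T ×ˢ (univ ×ˢ closedBall (0 : E) R)) volume) :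
    HasDistribTransportOn (Ioo 0 T) (fun z : ℝ × E × E => logTrunc κ (f z.1 z.2.1 z.2.2))
      (renormCollision κ δ B f) := by
  refine hasDistribTransportOn_of_hasDerivAt_characteristics (hf.locallyIntegrableOn_logTrunc hκ T)
    (hf.locallyIntegrableOn_renormCollision hBk.measurable hκ hκ1 hGL) (fun x v s hs => ?_)
    (fun x v => ?_)
  · exact (hf.hasDerivAt_logTrunc_sharp hδ hBk hCb hRb hκ hs.1 x v).1
  · exact (hf.continuousOn_renormCollision_sharp hδ hBk hCb hRb hκ x v).mono fun s hs => hs.1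

end Renormalised

end Literature.MathematicalPhysics.KineticTheory

/-! ## The hypotheses of the velocity averaging lemma for the renormalised approximating sequence -/

namespace Literature.MathematicalPhysics.KineticTheory

open Literature.Analysis.FluidPDE Literature.Analysis.FunctionSpaces

section Helpers2

variable {α : Type*} [MeasurableSpace α] {μ : Measure α}

/-- Uniform integrability by domination by a combination of two uniformly integrable families:
`‖g i‖ ≤ c (‖f i‖ + ‖f' i‖)` a.e. [folklore] -/
theorem uniformIntegrable_of_ae_le_mul_add {ι : Type*} {f f' g : ι → α → ℝ}
    (hf : UniformIntegrable f 1 μ) (hf' : UniformIntegrable f' 1 μ)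
    (hg : ∀ i, AEStronglyMeasurable (g i) μ) {c : ℝ} (hc : 0 ≤ c)
    (h : ∀ i, ∀ᵐ x ∂μ, ‖g i x‖ ≤ c * (‖f i x‖ + ‖f' i x‖)) : UniformIntegrable g 1 μ := by
  obtain ⟨hfm, hfU, C, hC⟩ := hf
  obtain ⟨hfm', hfU', C', hC'⟩ := hf'
  -- the dominating family `‖f i‖ + ‖f' i‖`
  set F : ι → α → ℝ := fun i x => ‖f i x‖ + ‖f' i x‖ with hF
  have hFU : UnifIntegrable F 1 μ := by
    have h1 : UnifIntegrable (fun i x => ‖f i x‖) 1 μ :=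
      unifIntegrable_of_ae_le hfU fun i => ae_of_all _ fun x => by simp
    have h2 : UnifIntegrable (fun i x => ‖f' i x‖) 1 μ :=
      unifIntegrable_of_ae_le hfU' fun i => ae_of_all _ fun x => by simp
    have := h1.add h2 le_rfl (fun i => (hfm i).norm) (fun i => (hfm' i).norm)
    exact this
  have hF0 : ∀ i x, 0 ≤ F i x := fun i x => add_nonneg (norm_nonneg _) (norm_nonneg _)
  refine ⟨hg, ?_, ENNReal.ofReal c * (C + C') |>.toNNReal, fun i => ?_⟩
  · refine unifIntegrable_of_dominated_split hFU fun ε hε => ⟨⟨c, hc⟩, 0, fun i =>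
      ⟨fun _ => 0, aemeasurable_const, by simp, ?_⟩⟩
    filter_upwards [h i] with x hx
    simp only [ENNReal.coe_zero, add_zero]
    rw [← ofReal_norm, ← ofReal_norm, Real.norm_of_nonneg (hF0 i x), ENNReal.coe_nnreal_eq]
    change ENNReal.ofReal ‖g i x‖ ≤ ENNReal.ofReal c * ENNReal.ofReal (F i x)
    rw [← ENNReal.ofReal_mul hc]
    exact ENNReal.ofReal_le_ofReal hx
  · have hfin : ENNReal.ofReal c * (C + C') ≠ ∞ :=
      ENNReal.mul_ne_top ENNReal.ofReal_ne_top (by simp)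
    rw [ENNReal.coe_toNNReal hfin]
    rw [eLpNorm_one_eq_lintegral_enorm] at *
    calc ∫⁻ x, ‖g i x‖ₑ ∂μ ≤ ∫⁻ x, ENNReal.ofReal c * (‖f i x‖ₑ + ‖f' i x‖ₑ) ∂μ := by
          refine lintegral_mono_ae ((h i).mono fun x hx => ?_)
          rw [← ofReal_norm, ← ofReal_norm, ← ofReal_norm, ← ENNReal.ofReal_add (norm_nonneg _)
            (norm_nonneg _), ← ENNReal.ofReal_mul hc]
          exact ENNReal.ofReal_le_ofReal hx
      _ = ENNReal.ofReal c * ((∫⁻ x, ‖f i x‖ₑ ∂μ) + ∫⁻ x, ‖f' i x‖ₑ ∂μ) := by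
          rw [lintegral_const_mul' _ _ ENNReal.ofReal_ne_top,
            lintegral_add_left' (hfm i).aemeasurable.enorm]
      _ ≤ ENNReal.ofReal c * (C + C') := by
          gcongr
          · simpa [eLpNorm_one_eq_lintegral_enorm] using hC i
          · simpa [eLpNorm_one_eq_lintegral_enorm] using hC' i

end Helpers2

section Setting

universe u

variable {E : Type u} [NormedAddCommGroup E] [InnerProductSpace ℝ E] [FiniteDimensional ℝ E]
  [MeasurableSpace E] [BorelSpace E]

/-- Each member of a uniformly integrable (`p = 1`) family is integrable. [folklore] -/
theorem integrable_of_uniformIntegrable {α ι : Type*} [MeasurableSpace α] {μ : Measure α}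
    {f : ι → α → ℝ} (hf : UniformIntegrable f 1 μ) (i : ι) : Integrable (f i) μ :=
  memLp_one_iff_integrable.1 (hf.memLp i)

/-- The renormalised collision term of an approximate solution is a.e. strongly measurable on every
measurable subset of `{t > 0}`. [folklore] -/
theorem IsDiPernaLionsApproximateSolution.aestronglyMeasurable_renormCollision {δ : ℝ}
    {B : E × E → sphere (0 : E) 1 → ℝ} {f : ℝ → E → E → ℝ}
    (hf : IsDiPernaLionsApproximateSolution δ B f) (hBm : Measurable (Function.uncurry B)) (κ : ℝ)
    {S : Set (ℝ × E × E)} (hSm : MeasurableSet S) (hS : S ⊆ Ioi 0 ×ˢ univ) :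
    AEStronglyMeasurable (renormCollision κ δ B f) (volume.restrict S) := by
  obtain ⟨H, hHm, hH⟩ := hf.exists_measurable_eq_renormCollision hBm κ
  refine hHm.aestronglyMeasurable.congr ?_
  filter_upwards [ae_restrict_mem hSm] with z hz
  exact hH z (mem_prod.1 (hS hz)).1

/-- **Membership in Lemma 5.3.7's families**: for the approximating sequence, the normalised weighted
gain and loss terms of each `fⁿ` are integrable on every box `(0,T) × E × B̄_R`. [cite: CIPDiluteGases1994, §5.3 Lemma 5.3.7 (p. 148)] -/
theorem integrableOn_normGain_normLoss_box {B : E × E → sphere (0 : E) 1 → ℝ}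
    (hB : KineticTheory.IsDiPernaLionsKernel B) {f₀ : E → E → ℝ} (hf₀ : HasDiPernaLionsData f₀)
    {δ : ℕ → ℝ} {Bseq : ℕ → E × E → sphere (0 : E) 1 → ℝ} {fseq : ℕ → ℝ → E → E → ℝ}
    (hδ : ∀ n, 0 < δ n) (hanti : Antitone δ) (hlim : Tendsto δ atTop (𝓝 0))
    (hker : IsDiPernaLionsKernelApproximation B Bseq)
    (hdata : IsDiPernaLionsDataApproximation f₀ (fun n => fseq n 0))
    (hsol : ∀ n, IsDiPernaLionsApproximateSolution (δ n) (Bseq n) (fseq n))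
    (hbd : UniformDiPernaLionsBounds δ Bseq fseq) (n : ℕ) (T R : ℝ) :
    IntegrableOn (normGain (δ n) (Bseq n) (fseq n)) (Ioo 0 T ×ˢ (univ ×ˢ closedBall (0 : E) R)) volume ∧
    IntegrableOn (normLoss (δ n) (Bseq n) (fseq n)) (Ioo 0 T ×ˢ (univ ×ˢ closedBall (0 : E) R)) volume := by
  obtain ⟨⟨hGU, -⟩, ⟨hLU, -⟩⟩ :=
    diPernaLions_approx_collisionTerms_weaklyCompact_holds hB hf₀ hδ hanti hlim hker hdata hsol hbd T R
  exact ⟨integrable_of_uniformIntegrable hGU n, integrable_of_uniformIntegrable hLU n⟩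

/-- **Weak `L¹_loc` compactness of `T β_κ(fⁿ)`** (hypothesis (ii) of CIP 1994 Lemma 5.3.10 for the
approximating sequence, from Lemma 5.3.7): for `0 < κ ≤ 1`, the renormalised collision terms
`β_κ'(fⁿ) Q̃ₙ(fⁿ,fⁿ)` form a uniformly integrable family on every compact subset of the open slab
`(0,T) × E × E` (they are bounded by `κ⁻¹ (|Gₙ| + |Lₙ|)`). [cite: CIPDiluteGases1994, §5.3 Lemma 5.3.10 (ii) (p. 155)] -/
theorem uniformIntegrable_renormCollision_of_isCompact {B : E × E → sphere (0 : E) 1 → ℝ}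
    (hB : KineticTheory.IsDiPernaLionsKernel B) {f₀ : E → E → ℝ} (hf₀ : HasDiPernaLionsData f₀)
    {δ : ℕ → ℝ} {Bseq : ℕ → E × E → sphere (0 : E) 1 → ℝ} {fseq : ℕ → ℝ → E → E → ℝ}
    (hδ : ∀ n, 0 < δ n) (hanti : Antitone δ) (hlim : Tendsto δ atTop (𝓝 0))
    (hker : IsDiPernaLionsKernelApproximation B Bseq)
    (hdata : IsDiPernaLionsDataApproximation f₀ (fun n => fseq n 0))
    (hsol : ∀ n, IsDiPernaLionsApproximateSolution (δ n) (Bseq n) (fseq n))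
    (hbd : UniformDiPernaLionsBounds δ Bseq fseq) {κ : ℝ} (hκ : 0 < κ) (hκ1 : κ ≤ 1) {T : ℝ}
    {K : Set (ℝ × E × E)} (hK : IsCompact K) (hKS : K ⊆ Ioo 0 T ×ˢ univ) :
    UniformIntegrable (fun n => renormCollision κ (δ n) (Bseq n) (fseq n)) 1 (volume.restrict K) := by
  -- a box containing `K`
  obtain ⟨R, hR⟩ := hK.isBounded.exists_norm_le
  set Box : Set (ℝ × E × E) := Ioo 0 T ×ˢ ((univ : Set E) ×ˢ closedBall (0 : E) R) with hBox
  have hBoxm : MeasurableSet Box :=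
    measurableSet_Ioo.prod (MeasurableSet.univ.prod measurableSet_closedBall)
  have hKBox : K ⊆ Box := by
    intro z hz
    refine ⟨(mem_prod.1 (hKS hz)).1, mem_univ _, ?_⟩
    rw [mem_closedBall, dist_zero_right]
    exact ((norm_snd_le z.2).trans (norm_snd_le z)).trans (hR z hz)
  have hBoxpos : Box ⊆ Ioi 0 ×ˢ univ := fun z hz => ⟨(mem_prod.1 hz).1.1, mem_univ _⟩
  -- Lemma 5.3.7 on the box
  obtain ⟨⟨hGU, -⟩, ⟨hLU, -⟩⟩ :=
    diPernaLions_approx_collisionTerms_weaklyCompact_holds hB hf₀ hδ hanti hlim hker hdata hsol hbd T R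
  have hU : UniformIntegrable (fun n => renormCollision κ (δ n) (Bseq n) (fseq n)) 1
      (volume.restrict Box) := by
    refine uniformIntegrable_of_ae_le_mul_add (f := fun n => normGain (δ n) (Bseq n) (fseq n))
      (f' := fun n => normLoss (δ n) (Bseq n) (fseq n)) hGU hLU
      (fun n => (hsol n).aestronglyMeasurable_renormCollision (hker.isDiPernaLionsKernel n).measurable
        κ hBoxm hBoxpos) (inv_nonneg.2 hκ.le) fun n => ?_
    filter_upwards [ae_restrict_mem hBoxm] with z hz
    rw [Real.norm_eq_abs, Real.norm_eq_abs, Real.norm_eq_abs]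
    exact abs_renormCollision_le hκ hκ1 ((hsol n).nonneg z.1 (mem_prod.1 hz).1.1.le _ _)
  exact uniformIntegrable_restrict_mono hU hK.measurableSet hKBox

/-- **The renormalised approximating sequence solves `T β_κ(fⁿ) = β_κ'(fⁿ) Q̃ₙ(fⁿ,fⁿ)` in `𝒟'`**, for
every `n`, `0 < κ ≤ 1` and `T`. [cite: CIPDiluteGases1994, §5.3 Lemma 5.3.10–5.3.11 (p. 155)] -/
theorem hasDistribTransportOn_logTrunc_approx {B : E × E → sphere (0 : E) 1 → ℝ}
    (hB : KineticTheory.IsDiPernaLionsKernel B) {f₀ : E → E → ℝ} (hf₀ : HasDiPernaLionsData f₀)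
    {δ : ℕ → ℝ} {Bseq : ℕ → E × E → sphere (0 : E) 1 → ℝ} {fseq : ℕ → ℝ → E → E → ℝ}
    (hδ : ∀ n, 0 < δ n) (hanti : Antitone δ) (hlim : Tendsto δ atTop (𝓝 0))
    (hker : IsDiPernaLionsKernelApproximation B Bseq)
    (hdata : IsDiPernaLionsDataApproximation f₀ (fun n => fseq n 0))
    (hsol : ∀ n, IsDiPernaLionsApproximateSolution (δ n) (Bseq n) (fseq n))
    (hbd : UniformDiPernaLionsBounds δ Bseq fseq) {κ : ℝ} (hκ : 0 < κ) (hκ1 : κ ≤ 1) (n : ℕ) (T : ℝ) :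
    HasDistribTransportOn (Ioo 0 T) (fun z : ℝ × E × E => logTrunc κ (fseq n z.1 z.2.1 z.2.2))
      (renormCollision κ (δ n) (Bseq n) (fseq n)) := by
  obtain ⟨Cb, hCb⟩ := hker.bounded n
  obtain ⟨Rb, hRb⟩ := hker.eq_zero_of_le n
  exact (hsol n).hasDistribTransportOn_logTrunc (hδ n).le (hker.isDiPernaLionsKernel n) hCb hRb hκ hκ1
    fun R => integrableOn_normGain_normLoss_box hB hf₀ hδ hanti hlim hker hdata hsol hbd n T R

end Setting

end Literature.MathematicalPhysics.KineticTheory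

/-! ## Velocity integrals: linearity, `L¹` bounds and weak limits -/

namespace Literature.MathematicalPhysics.KineticTheory

open Literature.Analysis.FluidPDE Literature.Analysis.FunctionSpaces

section VelocityIntegrals

variable {E : Type*} [NormedAddCommGroup E] [InnerProductSpace ℝ E] [FiniteDimensional ℝ E]
  [MeasurableSpace E] [BorelSpace E]

/-- Almost every velocity section of a function integrable on the slab is integrable. [folklore] -/
theorem ae_integrable_velocity_section {T : ℝ} {H : ℝ × E × E → ℝ}
    (hH : Integrable H (slabMeasure E T)) :
    ∀ᵐ p : ℝ × E ∂(baseSlabMeasure E T), Integrable (fun ξ : E => H (p.1, p.2, ξ)) volume := by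
  haveI : SigmaFinite (baseSlabMeasure E T) := by rw [baseSlabMeasure_def]; infer_instance
  have hmp := measurePreserving_slabAssoc (E := E) T
  have hH' : Integrable (H ∘ slabAssoc) ((baseSlabMeasure E T).prod volume) :=
    (hmp.integrable_comp_emb (slabAssoc (E := E)).measurableEmbedding).2 hH
  simpa using hH'.prod_right_ae

/-- Linearity of velocity integrals, almost everywhere in `(t, x)`. [folklore] -/
theorem integral_velocity_sub_ae {T : ℝ} {H₁ H₂ : ℝ × E × E → ℝ}
    (h₁ : Integrable H₁ (slabMeasure E T)) (h₂ : Integrable H₂ (slabMeasure E T)) :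
    (fun p : ℝ × E => (∫ ξ : E, H₁ (p.1, p.2, ξ)) - ∫ ξ : E, H₂ (p.1, p.2, ξ)) =ᵐ[baseSlabMeasure E T]
      fun p => ∫ ξ : E, (H₁ (p.1, p.2, ξ) - H₂ (p.1, p.2, ξ)) := by
  filter_upwards [ae_integrable_velocity_section h₁, ae_integrable_velocity_section h₂] with p hp₁ hp₂
  exact (integral_sub hp₁ hp₂).symm

/-- **`L¹` bound for differences of velocity averages with a bounded weight**:
`‖∫ u ψ dξ - ∫ u' ψ dξ‖_{L¹((0,T) × E)} ≤ M ‖u - u'‖_{L¹((0,T) × E × E)}` for `|ψ| ≤ M` a.e.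
[folklore] -/
theorem integral_abs_velocityIntegral_sub_le {T : ℝ} {ψ u u' : ℝ × E × E → ℝ} {M : ℝ}
    (hψ : AEStronglyMeasurable ψ (slabMeasure E T)) (hM : ∀ᵐ z ∂(slabMeasure E T), |ψ z| ≤ M)
    (hu : Integrable u (slabMeasure E T)) (hu' : Integrable u' (slabMeasure E T)) :
    ∫ p, |velocityIntegral ψ u p - velocityIntegral ψ u' p| ∂(baseSlabMeasure E T) ≤
      M * ∫ z, |u z - u' z| ∂(slabMeasure E T) := by
  have hM' : ∀ᵐ z ∂(slabMeasure E T), ‖ψ z‖ ≤ M := hM.mono fun z hz => (Real.norm_eq_abs _).le.trans hz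
  have h₁ : Integrable (fun z => u z * ψ z) (slabMeasure E T) := hu.mul_bdd hψ hM'
  have h₂ : Integrable (fun z => u' z * ψ z) (slabMeasure E T) := hu'.mul_bdd hψ hM'
  have hH : Integrable (fun z => (u z - u' z) * ψ z) (slabMeasure E T) := (hu.sub hu').mul_bdd hψ hM'
  have hae := integral_velocity_sub_ae h₁ h₂
  calc ∫ p, |velocityIntegral ψ u p - velocityIntegral ψ u' p| ∂(baseSlabMeasure E T)
      = ∫ p : ℝ × E, |(∫ ξ : E, (u (p.1, p.2, ξ) - u' (p.1, p.2, ξ)) * ψ (p.1, p.2, ξ))|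
          ∂(baseSlabMeasure E T) := by
        refine integral_congr_ae (hae.mono fun p hp => ?_)
        simp only [velocityIntegral] at hp ⊢
        rw [hp]
        congr 1
        refine integral_congr_ae (ae_of_all _ fun ξ => ?_)
        ring
    _ ≤ ∫ z, |(u z - u' z) * ψ z| ∂(slabMeasure E T) := (integrable_integral_velocity hH).2.1
    _ ≤ ∫ z, M * |u z - u' z| ∂(slabMeasure E T) := by
        refine integral_mono_ae hH.abs ((hu.sub hu').abs.const_mul M) ?_
        filter_upwards [hM] with z hz
        rw [abs_mul, mul_comm]
        exact mul_le_mul_of_nonneg_right hz (abs_nonneg _)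
    _ = M * ∫ z, |u z - u' z| ∂(slabMeasure E T) := integral_const_mul _ _

/-- **Weak `L¹` convergence of velocity integrals** from weak `L¹` convergence of the integrands on
the slab (Fubini: testing `∫ uₖ ψₖ dξ` against `φ(t,x)` is testing `uₖ ψₖ` against `φ` lifted to the
slab). [folklore] -/
theorem tendstoWeaklyL1_velocityIntegral {T : ℝ} {u ψ : ℕ → ℝ × E × E → ℝ} {U Ψ : ℝ × E × E → ℝ}
    (hint : ∀ k, Integrable (fun z => u k z * ψ k z) (slabMeasure E T))
    (hlim : Integrable (fun z => U z * Ψ z) (slabMeasure E T))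
    (hw : TendstoWeaklyL1 (fun k z => u k z * ψ k z) (fun z => U z * Ψ z) (slabMeasure E T)) :
    TendstoWeaklyL1 (fun k => velocityIntegral (ψ k) (u k)) (velocityIntegral Ψ U)
      (baseSlabMeasure E T) := by
  intro φ C hφ hC
  have h1 : ∀ k, ∫ p, velocityIntegral (ψ k) (u k) p * φ p ∂(baseSlabMeasure E T) =
      ∫ z, (u k z * ψ k z) * φ (z.1, z.2.1) ∂(slabMeasure E T) := fun k =>
    integral_integral_velocity_mul (H := fun z => u k z * ψ k z) (hint k) hφ hC
  have h2 : ∫ p, velocityIntegral Ψ U p * φ p ∂(baseSlabMeasure E T) =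
      ∫ z, (U z * Ψ z) * φ (z.1, z.2.1) ∂(slabMeasure E T) :=
    integral_integral_velocity_mul (H := fun z => U z * Ψ z) hlim hφ hC
  simp only [h1, h2]
  exact hw _ C (aestronglyMeasurable_comp_base hφ) (ae_comp_base hC)

end VelocityIntegrals

/-! ## The truncation error (3.30)/(3.34) on slabs -/

section Truncation

universe u

variable {E : Type u} [NormedAddCommGroup E] [InnerProductSpace ℝ E] [FiniteDimensional ℝ E]
  [MeasurableSpace E] [BorelSpace E]

/-- **(3.34) on slabs**: `‖fⁿ - β_κ(fⁿ)‖_{L¹((0,T) × E × E)} ≤ T (κ L + (log L)⁻¹) C` for every `L > 1`,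
uniformly in `n`, where `C` bounds the mass–moment–entropy functional of the slices on `[0,T]`
((3.30) slice by slice, `lintegral_sub_logTrunc_le`, and Tonelli). [cite: CIPDiluteGases1994, §5.3 (3.30), (3.34) (pp. 151, 155)] -/
theorem integral_abs_sub_logTrunc_slab_le {δ : ℕ → ℝ} {Bseq : ℕ → E × E → sphere (0 : E) 1 → ℝ}
    {fseq : ℕ → ℝ → E → E → ℝ} (hsol : ∀ n, IsDiPernaLionsApproximateSolution (δ n) (Bseq n) (fseq n))
    {T : ℝ} (hT : 0 ≤ T) {C : ℝ} (hC0 : 0 ≤ C)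
    (hC : ∀ n, ∀ t ∈ Icc 0 T, ∫⁻ z : E × E, ENNReal.ofReal (fseq n t z.1 z.2 *
      (1 + ‖z.1‖ ^ 2 + ‖z.2‖ ^ 2 + |log (fseq n t z.1 z.2)|)) ∂(volume.prod volume) ≤ ENNReal.ofReal C)
    {κ L : ℝ} (hκ : 0 < κ) (hL : 1 < L) (n : ℕ) :
    ∫ z, |fseq n z.1 z.2.1 z.2.2 - logTrunc κ (fseq n z.1 z.2.1 z.2.2)| ∂(slabMeasure E T) ≤
      T * ((κ * L + (log L)⁻¹) * C) := by
  set D : ℝ × E × E → ℝ := fun z => fseq n z.1 z.2.1 z.2.2 - logTrunc κ (fseq n z.1 z.2.1 z.2.2) with hD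
  have hKnn : 0 ≤ (κ * L + (log L)⁻¹) * C := by
    have := log_pos hL; positivity
  have hmeas : AEStronglyMeasurable D (slabMeasure E T) := by
    have hF := (hsol n).aestronglyMeasurable_slab T
    exact hF.sub ((measurable_logTrunc κ).comp_aemeasurable hF.aemeasurable).aestronglyMeasurable
  have hnn : 0 ≤ᵐ[slabMeasure E T] D := by
    rw [slabMeasure_def]
    filter_upwards [ae_restrict_mem (measurableSet_Ioo.prod MeasurableSet.univ)] with z hz
    exact sub_nonneg.2 (logTrunc_le hκ ((hsol n).nonneg z.1 (mem_prod.1 hz).1.1.le _ _))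
  have habs : ∀ᵐ z ∂(slabMeasure E T), |D z| = D z := hnn.mono fun z hz => abs_of_nonneg hz
  -- the lower-integral bound by Tonelli and (3.30)
  have hlin : ∫⁻ z, ENNReal.ofReal (D z) ∂(slabMeasure E T) ≤
      ENNReal.ofReal T * ENNReal.ofReal ((κ * L + (log L)⁻¹) * C) := by
    refine lintegral_slab_le hmeas.aemeasurable.ennreal_ofReal fun t ht => ?_
    exact lintegral_sub_logTrunc_le (g := fun z : E × E => fseq n t z.1 z.2)
      (fun z => (hsol n).nonneg t ht.1.le _ _) (hC n t ⟨ht.1.le, ht.2.le⟩) hκ hL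
  calc ∫ z, |D z| ∂(slabMeasure E T) = ∫ z, D z ∂(slabMeasure E T) := integral_congr_ae habs
    _ = (∫⁻ z, ENNReal.ofReal (D z) ∂(slabMeasure E T)).toReal :=
        integral_eq_lintegral_of_nonneg_ae hnn hmeas
    _ ≤ (ENNReal.ofReal T * ENNReal.ofReal ((κ * L + (log L)⁻¹) * C)).toReal :=
        ENNReal.toReal_mono (ENNReal.mul_ne_top ENNReal.ofReal_ne_top ENNReal.ofReal_ne_top) hlin
    _ = T * ((κ * L + (log L)⁻¹) * C) := by
        rw [ENNReal.toReal_mul, ENNReal.toReal_ofReal hT, ENNReal.toReal_ofReal hKnn]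

/-- Choice of the truncation parameters: for `A ≥ 0` and `ε > 0` there are `L > 1` and
`κ ∈ (0, 1]` with `(κ L + (log L)⁻¹) A ≤ ε`. [folklore] -/
theorem exists_trunc_params {A ε : ℝ} (hA : 0 ≤ A) (hε : 0 < ε) :
    ∃ κ L : ℝ, 0 < κ ∧ κ ≤ 1 ∧ 1 < L ∧ (κ * L + (log L)⁻¹) * A ≤ ε := by
  set L : ℝ := exp ((A + 1) * (2 / ε)) with hL
  have hexp : 0 < (A + 1) * (2 / ε) := by positivity
  have hL1 : 1 < L := by rw [hL]; exact Real.one_lt_exp_iff.2 hexp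
  have hL0 : 0 < L := zero_lt_one.trans hL1
  have hlogL : log L = (A + 1) * (2 / ε) := by rw [hL, log_exp]
  set κ : ℝ := min 1 (ε / (2 * (L * A + 1))) with hκ
  have hκpos : 0 < κ := lt_min one_pos (by positivity)
  refine ⟨κ, L, hκpos, min_le_left _ _, hL1, ?_⟩
  have h1 : (log L)⁻¹ * A ≤ ε / 2 := by
    rw [hlogL, ← div_eq_inv_mul, div_le_iff₀ hexp]
    have : A * ε ≤ (A + 1) * ε := by nlinarith
    calc A = A * ε / ε := by field_simp
      _ ≤ ε / 2 * ((A + 1) * (2 / ε)) := by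
          rw [div_le_iff₀ hε]
          have h' : ε / 2 * ((A + 1) * (2 / ε)) * ε = (A + 1) * ε := by field_simp
          rw [h']; exact this
  have h2 : κ * L * A ≤ ε / 2 := by
    have hκle : κ ≤ ε / (2 * (L * A + 1)) := min_le_right _ _
    calc κ * L * A = κ * (L * A) := by ring
      _ ≤ ε / (2 * (L * A + 1)) * (L * A) := mul_le_mul_of_nonneg_right hκle (by positivity)
      _ ≤ ε / 2 := by
          rw [div_mul_eq_mul_div, div_le_div_iff₀ (by positivity) (by positivity)]
          nlinarith [mul_nonneg hL0.le hA]
  calc (κ * L + (log L)⁻¹) * A = κ * L * A + (log L)⁻¹ * A := by ring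
    _ ≤ ε / 2 + ε / 2 := add_le_add h2 h1
    _ = ε := add_halves ε

end Truncation

end Literature.MathematicalPhysics.KineticTheory

/-! ## CIP Lemma 5.3.10 for the approximating sequence: strong convergence of velocity averages -/

namespace Literature.MathematicalPhysics.KineticTheory

open Literature.Analysis.FluidPDE Literature.Analysis.FunctionSpaces

section Main

universe u

variable {E : Type u} [NormedAddCommGroup E] [InnerProductSpace ℝ E] [FiniteDimensional ℝ E]
  [MeasurableSpace E] [BorelSpace E]

/-- The `L¹` norm of a member of a uniformly integrable family is bounded by the uniform bound.
[folklore] -/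
theorem exists_integral_abs_le_of_uniformIntegrable {α : Type*} [MeasurableSpace α] {μ : Measure α}
    {f : ℕ → α → ℝ} (hf : UniformIntegrable f 1 μ) : ∃ K : ℝ, ∀ n, ∫ x, |f n x| ∂μ ≤ K := by
  obtain ⟨hm, hU, C, hC⟩ := hf
  refine ⟨C, fun n => ?_⟩
  have hint : Integrable (f n) μ := integrable_of_uniformIntegrable ⟨hm, hU, C, hC⟩ n
  have h1 : ENNReal.ofReal (∫ x, |f n x| ∂μ) ≤ (C : ℝ≥0∞) := by
    have := ofReal_integral_norm_eq_lintegral_enorm hint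
    rw [← eLpNorm_one_eq_lintegral_enorm] at this
    simpa only [Real.norm_eq_abs] using this.le.trans (hC n)
  have h2 := ENNReal.toReal_mono ENNReal.coe_ne_top h1
  rwa [ENNReal.toReal_ofReal (integral_nonneg fun x => abs_nonneg _), ENNReal.coe_toReal] at h2

/-- **The key step of CIP 1994 Lemma 5.3.10 for the approximating sequence**: along every
subsequence there is an index at which the velocity average `∫ f^{φ(k)} ψₖ dξ` is `ε`-close in
`L¹((0,T) × E)` to `∫ f ψ dξ`. Proof (CIP pp. 155–156): replace `fⁿ` by `β_κ(fⁿ)` at a cost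
`sup_n ‖fⁿ - β_κ(fⁿ)‖₁ ≤ e(κ)` ((3.34)); by Lemma 5.3.9 (`velocityAverage_relativelyCompact_L1`) the
averages `∫ β_κ(fⁿ) ψₙ dξ` converge in `L¹` along a further subsequence, and the limit is identified
as `∫ g_κ ψ dξ`, `g_κ` a weak limit of `β_κ(fⁿ)` (Dunford–Pettis), by the weak continuity of
products with bounded a.e.-convergent factors; finally `‖f - g_κ‖₁ ≤ e(κ)` by weak lower
semicontinuity of the norm, and `e(κ) → 0`. [cite: CIPDiluteGases1994, §5.3 Lemma 5.3.10 (pp. 155–156)] -/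
theorem exists_integral_abs_velocityAverage_sub_lt
    (h9 : velocityAverage_relativelyCompact_L1.{u})
    {B : E × E → sphere (0 : E) 1 → ℝ} (hB : KineticTheory.IsDiPernaLionsKernel B)
    {f₀ : E → E → ℝ} (hf₀ : HasDiPernaLionsData f₀)
    {δ : ℕ → ℝ} {Bseq : ℕ → E × E → sphere (0 : E) 1 → ℝ} {fseq : ℕ → ℝ → E → E → ℝ}
    (hδ : ∀ n, 0 < δ n) (hanti : Antitone δ) (hlim : Tendsto δ atTop (𝓝 0))
    (hker : IsDiPernaLionsKernelApproximation B Bseq)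
    (hdata : IsDiPernaLionsDataApproximation f₀ (fun n => fseq n 0))
    (hsol : ∀ n, IsDiPernaLionsApproximateSolution (δ n) (Bseq n) (fseq n))
    (hbd : UniformDiPernaLionsBounds δ Bseq fseq) {φ : ℕ → ℕ} {f : ℝ → E → E → ℝ}
    (hW : IsDiPernaLionsWeakLimit f₀ fseq φ f)
    {T : ℝ} {ψ : ℕ → ℝ × E × E → ℝ} {ψlim : ℝ × E × E → ℝ} {M : ℝ}
    (hψm : ∀ k, AEStronglyMeasurable (ψ k) (slabMeasure E T))
    (hψM : ∀ k, ∀ᵐ z ∂(slabMeasure E T), |ψ k z| ≤ M)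
    (hψlim : ∀ᵐ z ∂(slabMeasure E T), Tendsto (fun k => ψ k z) atTop (𝓝 (ψlim z)))
    {ε : ℝ} (hε : 0 < ε) {θ : ℕ → ℕ} (hθ : StrictMono θ) :
    ∃ j, ∫ p, |velocityIntegral (ψ (θ j)) (fun z => fseq (φ (θ j)) z.1 z.2.1 z.2.2) p -
        velocityIntegral ψlim (fun z => f z.1 z.2.1 z.2.2) p| ∂(baseSlabMeasure E T) < ε := by
  -- the trivial case `T ≤ 0`
  rcases le_or_gt T 0 with hT | hT
  · refine ⟨0, ?_⟩
    have hzero : baseSlabMeasure E T = 0 := by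
      rw [baseSlabMeasure_def, Ioo_eq_empty (not_lt.2 hT), empty_prod, Measure.restrict_empty]
    simpa [hzero] using hε
  haveI : SigmaFinite (slabMeasure E T) := by rw [slabMeasure_def]; infer_instance
  haveI : SigmaFinite (baseSlabMeasure E T) := by rw [baseSlabMeasure_def]; infer_instance
  -- notation
  set F : ℕ → ℝ × E × E → ℝ := fun k z => fseq (φ k) z.1 z.2.1 z.2.2 with hFdef
  set Finf : ℝ × E × E → ℝ := fun z => f z.1 z.2.1 z.2.2 with hFinfdef
  set M₀ : ℝ := max M 0 with hM₀def
  have hM₀ : 0 ≤ M₀ := le_max_right _ _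
  have hψM₀ : ∀ k, ∀ᵐ z ∂(slabMeasure E T), |ψ k z| ≤ M₀ := fun k =>
    (hψM k).mono fun z hz => hz.trans (le_max_left _ _)
  -- ### basic facts on the approximating sequence and its limit
  have hslab : ∀ᵐ z ∂(slabMeasure E T), z ∈ Ioo 0 T ×ˢ (univ : Set (E × E)) := by
    rw [slabMeasure_def]; exact ae_restrict_mem (measurableSet_Ioo.prod MeasurableSet.univ)
  have hFUI : UniformIntegrable F 1 (slabMeasure E T) ∧ UnifTight F 1 (slabMeasure E T) := by
    have h := uniformIntegrable_unifTight_slab hsol hbd T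
    exact ⟨uniformIntegrable_comp_subseq h.1 φ, unifTight_comp_subseq h.2 φ⟩
  have hFint : ∀ k, Integrable (F k) (slabMeasure E T) := integrable_of_uniformIntegrable hFUI.1
  have hFinf_int : Integrable Finf (slabMeasure E T) := by
    have := (hW.integrableOn_slab T).mono_set (prod_mono (Ioo_subset_Icc_self) (Subset.refl _))
    rw [slabMeasure_def]; exact this
  have hFw : TendstoWeaklyL1 F Finf (slabMeasure E T) := hW.tendstoWeaklyL1_slab T
  have hF0 : ∀ k, ∀ᵐ z ∂(slabMeasure E T), 0 ≤ F k z := fun k =>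
    hslab.mono fun z hz => (hsol _).nonneg z.1 (mem_prod.1 hz).1.1.le _ _
  -- the limit weight
  have hψlim_m : AEStronglyMeasurable ψlim (slabMeasure E T) :=
    aestronglyMeasurable_of_tendsto_ae atTop hψm hψlim
  have hψlimM : ∀ᵐ z ∂(slabMeasure E T), |ψlim z| ≤ M₀ := by
    have hall : ∀ᵐ z ∂(slabMeasure E T), ∀ k, |ψ k z| ≤ M₀ := ae_all_iff.2 hψM₀
    filter_upwards [hall, hψlim] with z h1 h2
    exact le_of_tendsto ((continuous_abs.tendsto _).comp h2) (Eventually.of_forall h1)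
  -- ### the truncation parameters
  obtain ⟨C, hC⟩ := hbd.massEntropy_le T hT.le
  set Cp : ℝ := max C 0 with hCpdef
  have hC' : ∀ n, ∀ t ∈ Icc 0 T, ∫⁻ z : E × E, ENNReal.ofReal (fseq n t z.1 z.2 *
      (1 + ‖z.1‖ ^ 2 + ‖z.2‖ ^ 2 + |log (fseq n t z.1 z.2)|)) ∂(volume.prod volume) ≤
      ENNReal.ofReal Cp := fun n t ht => (hC n t ht).trans (ENNReal.ofReal_le_ofReal (le_max_left _ _))
  have hε4 : 0 < ε / 4 := by positivity
  obtain ⟨κ, L, hκ, hκ1, hL, hsmall⟩ := exists_trunc_params (A := M₀ * T * Cp) (by positivity) hε4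
  set e : ℝ := T * ((κ * L + (log L)⁻¹) * Cp) with hedef
  have he0 : 0 ≤ e := by have := log_pos hL; positivity
  have hMe : M₀ * e ≤ ε / 4 := by
    calc M₀ * e = (κ * L + (log L)⁻¹) * (M₀ * T * Cp) := by rw [hedef]; ring
      _ ≤ ε / 4 := hsmall
  have he : ∀ n, ∫ z, |fseq n z.1 z.2.1 z.2.2 - logTrunc κ (fseq n z.1 z.2.1 z.2.2)| ∂(slabMeasure E T) ≤ e :=
    fun n => integral_abs_sub_logTrunc_slab_le hsol hT.le (le_max_right C 0) hC' hκ hL n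
  -- ### the renormalised sequence and the hypotheses of Lemma 5.3.9
  set g : ℕ → ℝ × E × E → ℝ := fun k z => logTrunc κ (F k z) with hgdef
  set h : ℕ → ℝ × E × E → ℝ := fun k => renormCollision κ (δ (φ k)) (Bseq (φ k)) (fseq (φ k)) with hhdef
  have hgm : ∀ k, AEStronglyMeasurable (g k) (slabMeasure E T) := fun k =>
    ((measurable_logTrunc κ).comp_aemeasurable (hFint k).1.aemeasurable).aestronglyMeasurable
  have hg_le : ∀ k, ∀ᵐ z ∂(slabMeasure E T), ‖g k z‖ ≤ ‖F k z‖ := fun k =>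
    (hF0 k).mono fun z hz => by
      rw [Real.norm_eq_abs, Real.norm_eq_abs, abs_of_nonneg (logTrunc_nonneg hκ hz), abs_of_nonneg hz]
      exact logTrunc_le hκ hz
  have hgUI : UniformIntegrable g 1 (slabMeasure E T) := uniformIntegrable_of_ae_le hFUI.1 hgm hg_le
  have hgUT : UnifTight g 1 (slabMeasure E T) := unifTight_of_ae_le hFUI.2 hg_le
  have hgint : ∀ k, Integrable (g k) (slabMeasure E T) := integrable_of_uniformIntegrable hgUI
  have hge : ∀ k, ∫ z, |F k z - g k z| ∂(slabMeasure E T) ≤ e := fun k => he (φ k)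
  have htrans : ∀ k, HasDistribTransportOn (Ioo 0 T) (g k) (h k) := fun k =>
    hasDistribTransportOn_logTrunc_approx hB hf₀ hδ hanti hlim hker hdata hsol hbd hκ hκ1 (φ k) T
  have hhUI : ∀ K ⊆ Ioo 0 T ×ˢ univ, IsCompact K → UniformIntegrable h 1 (volume.restrict K) :=
    fun K hKS hK => uniformIntegrable_comp_subseq
      (uniformIntegrable_renormCollision_of_isCompact hB hf₀ hδ hanti hlim hker hdata hsol hbd hκ hκ1
        hK hKS) φ
  -- ### Lemma 5.3.9 along `θ`, then Dunford–Pettis along the resulting subsequence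
  obtain ⟨θ', hθ', ρ, hρ, hρlim⟩ := h9 hgUI hgUT htrans hhUI hψm ⟨M₀, hψM₀⟩ hψlim θ hθ
  obtain ⟨θ'', hθ'', G, hGint, hGw⟩ := dunfordPettis_exists_subseq_holds
    (uniformIntegrable_comp_subseq hgUI (θ ∘ θ')) (unifTight_comp_subseq hgUT (θ ∘ θ'))
  set Θ : ℕ → ℕ := fun j => θ (θ' (θ'' j)) with hΘdef
  have hΘ : StrictMono Θ := hθ.comp (hθ'.comp hθ'')
  have hGw' : TendstoWeaklyL1 (fun j => g (Θ j)) G (slabMeasure E T) := hGw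
  -- products with the weights converge weakly
  have hprod : TendstoWeaklyL1 (fun j z => g (Θ j) z * ψ (Θ j) z) (fun z => G z * ψlim z)
      (slabMeasure E T) :=
    hGw'.mul_of_tendsto_ae (fun j => hgint (Θ j))
      (exists_integral_abs_le_of_uniformIntegrable (uniformIntegrable_comp_subseq hgUI Θ))
      (uniformIntegrable_comp_subseq hgUI Θ).2.1 (unifTight_comp_subseq hgUT Θ)
      (fun j => hψm (Θ j)) (fun j => hψM₀ (Θ j)) (hψlim.mono fun z hz => hz.comp hΘ.tendsto_atTop)
  -- integrability of the products
  have hM₀' : ∀ k, ∀ᵐ z ∂(slabMeasure E T), ‖ψ k z‖ ≤ M₀ := fun k =>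
    (hψM₀ k).mono fun z hz => (Real.norm_eq_abs _).le.trans hz
  have hψlimM' : ∀ᵐ z ∂(slabMeasure E T), ‖ψlim z‖ ≤ M₀ :=
    hψlimM.mono fun z hz => (Real.norm_eq_abs _).le.trans hz
  have hgψ : ∀ k, Integrable (fun z => g k z * ψ k z) (slabMeasure E T) := fun k =>
    (hgint k).mul_bdd (hψm k) (hM₀' k)
  have hFψ : ∀ k, Integrable (fun z => F k z * ψ k z) (slabMeasure E T) := fun k =>
    (hFint k).mul_bdd (hψm k) (hM₀' k)
  have hGψ : Integrable (fun z => G z * ψlim z) (slabMeasure E T) := hGint.mul_bdd hψlim_m hψlimM'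
  have hFinfψ : Integrable (fun z => Finf z * ψlim z) (slabMeasure E T) :=
    hFinf_int.mul_bdd hψlim_m hψlimM'
  -- weak convergence of the velocity integrals and identification of `ρ`
  have hVIw : TendstoWeaklyL1 (fun j => velocityIntegral (ψ (Θ j)) (g (Θ j))) (velocityIntegral ψlim G)
      (baseSlabMeasure E T) :=
    tendstoWeaklyL1_velocityIntegral (fun j => hgψ (Θ j)) hGψ hprod
  have hVIint : ∀ k, Integrable (velocityIntegral (ψ k) (g k)) (baseSlabMeasure E T) := fun k =>
    (integrable_integral_velocity (hgψ k)).1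
  have hVIint' : ∀ k, Integrable (velocityIntegral (ψ k) (F k)) (baseSlabMeasure E T) := fun k =>
    (integrable_integral_velocity (hFψ k)).1
  have hVIG : Integrable (velocityIntegral ψlim G) (baseSlabMeasure E T) :=
    (integrable_integral_velocity hGψ).1
  have hVIF : Integrable (velocityIntegral ψlim Finf) (baseSlabMeasure E T) :=
    (integrable_integral_velocity hFinfψ).1
  have hρlim' : Tendsto (fun j => ∫ p, |velocityIntegral (ψ (Θ j)) (g (Θ j)) p - ρ p|
      ∂(baseSlabMeasure E T)) atTop (𝓝 0) := hρlim.comp hθ''.tendsto_atTop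
  have hρw : TendstoWeaklyL1 (fun j => velocityIntegral (ψ (Θ j)) (g (Θ j))) ρ (baseSlabMeasure E T) :=
    TendstoWeaklyL1.of_tendsto_integral_abs_sub (fun j => hVIint (Θ j)) hρ hρlim'
  have hρeq : ρ =ᵐ[baseSlabMeasure E T] velocityIntegral ψlim G := hρw.ae_eq hVIw hρ hVIG
  have hconv : Tendsto (fun j => ∫ p, |velocityIntegral (ψ (Θ j)) (g (Θ j)) p -
      velocityIntegral ψlim G p| ∂(baseSlabMeasure E T)) atTop (𝓝 0) := by
    refine hρlim'.congr fun j => integral_congr_ae (hρeq.mono fun p hp => ?_)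
    beta_reduce; rw [hp]
  -- ### the two truncation errors
  have herr1 : ∀ k, ∫ p, |velocityIntegral (ψ k) (F k) p - velocityIntegral (ψ k) (g k) p|
      ∂(baseSlabMeasure E T) ≤ M₀ * e := fun k =>
    (integral_abs_velocityIntegral_sub_le (hψm k) (hψM₀ k) (hFint k) (hgint k)).trans
      (mul_le_mul_of_nonneg_left (hge k) hM₀)
  have herr2 : ∫ p, |velocityIntegral ψlim Finf p - velocityIntegral ψlim G p|
      ∂(baseSlabMeasure E T) ≤ M₀ * e := by
    refine (integral_abs_velocityIntegral_sub_le hψlim_m hψlimM hFinf_int hGint).trans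
      (mul_le_mul_of_nonneg_left ?_ hM₀)
    -- weak lower semicontinuity of the `L¹` norm
    have hdiffw : TendstoWeaklyL1 (fun j z => F (Θ j) z - g (Θ j) z) (fun z => Finf z - G z)
        (slabMeasure E T) :=
      (hFw.comp_strictMono hΘ).sub hGw' (fun j => hFint (Θ j)) (fun j => hgint (Θ j)) hFinf_int hGint
    have hb : ∀ j, ∫⁻ z, ‖F (Θ j) z - g (Θ j) z‖ₑ ∂(slabMeasure E T) ≤ ENNReal.ofReal e := by
      intro j
      have hint : Integrable (fun z => F (Θ j) z - g (Θ j) z) (slabMeasure E T) :=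
        (hFint _).sub (hgint _)
      rw [← ofReal_integral_norm_eq_lintegral_enorm hint]
      exact ENNReal.ofReal_le_ofReal (by simpa only [Real.norm_eq_abs] using hge (Θ j))
    have hint' : Integrable (fun z => Finf z - G z) (slabMeasure E T) := hFinf_int.sub hGint
    have hle := hdiffw.lintegral_enorm_le_of_forall_le hint' he0 hb
    rw [← ofReal_integral_norm_eq_lintegral_enorm hint', ENNReal.ofReal_le_ofReal_iff he0] at hle
    simpa only [Real.norm_eq_abs] using hle
  -- ### conclusion: an index `j` with small total error
  obtain ⟨j, hj⟩ : ∃ j, ∫ p, |velocityIntegral (ψ (Θ j)) (g (Θ j)) p -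
      velocityIntegral ψlim G p| ∂(baseSlabMeasure E T) < ε / 2 :=
    ((tendsto_order.1 hconv).2 (ε / 2) (by positivity)).exists
  refine ⟨θ' (θ'' j), ?_⟩
  change ∫ p, |velocityIntegral (ψ (Θ j)) (F (Θ j)) p - velocityIntegral ψlim Finf p|
    ∂(baseSlabMeasure E T) < ε
  have htri : ∀ p, |velocityIntegral (ψ (Θ j)) (F (Θ j)) p - velocityIntegral ψlim Finf p| ≤
      |velocityIntegral (ψ (Θ j)) (F (Θ j)) p - velocityIntegral (ψ (Θ j)) (g (Θ j)) p| +
      |velocityIntegral (ψ (Θ j)) (g (Θ j)) p - velocityIntegral ψlim G p| +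
      |velocityIntegral ψlim Finf p - velocityIntegral ψlim G p| := by
    intro p
    have h1 := abs_sub_le (velocityIntegral (ψ (Θ j)) (F (Θ j)) p)
      (velocityIntegral (ψ (Θ j)) (g (Θ j)) p) (velocityIntegral ψlim Finf p)
    have h2 := abs_sub_le (velocityIntegral (ψ (Θ j)) (g (Θ j)) p) (velocityIntegral ψlim G p)
      (velocityIntegral ψlim Finf p)
    have h3 := abs_sub_comm (velocityIntegral ψlim G p) (velocityIntegral ψlim Finf p)
    linarith
  have hI1 : Integrable (fun p => |velocityIntegral (ψ (Θ j)) (F (Θ j)) p -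
      velocityIntegral (ψ (Θ j)) (g (Θ j)) p|) (baseSlabMeasure E T) := ((hVIint' _).sub (hVIint _)).abs
  have hI2 : Integrable (fun p => |velocityIntegral (ψ (Θ j)) (g (Θ j)) p - velocityIntegral ψlim G p|)
      (baseSlabMeasure E T) := ((hVIint _).sub hVIG).abs
  have hI3 : Integrable (fun p => |velocityIntegral ψlim Finf p - velocityIntegral ψlim G p|)
      (baseSlabMeasure E T) := (hVIF.sub hVIG).abs
  have hI12 : Integrable (fun p => |velocityIntegral (ψ (Θ j)) (F (Θ j)) p -
      velocityIntegral (ψ (Θ j)) (g (Θ j)) p| +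
      |velocityIntegral (ψ (Θ j)) (g (Θ j)) p - velocityIntegral ψlim G p|) (baseSlabMeasure E T) :=
    hI1.add hI2
  have hI123 : Integrable (fun p => |velocityIntegral (ψ (Θ j)) (F (Θ j)) p -
      velocityIntegral (ψ (Θ j)) (g (Θ j)) p| +
      |velocityIntegral (ψ (Θ j)) (g (Θ j)) p - velocityIntegral ψlim G p| +
      |velocityIntegral ψlim Finf p - velocityIntegral ψlim G p|) (baseSlabMeasure E T) :=
    hI12.add hI3
  calc ∫ p, |velocityIntegral (ψ (Θ j)) (F (Θ j)) p - velocityIntegral ψlim Finf p| ∂(baseSlabMeasure E T)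
      ≤ ∫ p, (|velocityIntegral (ψ (Θ j)) (F (Θ j)) p - velocityIntegral (ψ (Θ j)) (g (Θ j)) p| +
          |velocityIntegral (ψ (Θ j)) (g (Θ j)) p - velocityIntegral ψlim G p| +
          |velocityIntegral ψlim Finf p - velocityIntegral ψlim G p|) ∂(baseSlabMeasure E T) :=
        integral_mono_of_nonneg (ae_of_all _ fun p => abs_nonneg _) hI123 (ae_of_all _ htri)
    _ = (∫ p, |velocityIntegral (ψ (Θ j)) (F (Θ j)) p - velocityIntegral (ψ (Θ j)) (g (Θ j)) p|
            ∂(baseSlabMeasure E T)) +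
          (∫ p, |velocityIntegral (ψ (Θ j)) (g (Θ j)) p - velocityIntegral ψlim G p|
            ∂(baseSlabMeasure E T)) +
          ∫ p, |velocityIntegral ψlim Finf p - velocityIntegral ψlim G p| ∂(baseSlabMeasure E T) := by
        rw [integral_add hI12 hI3, integral_add hI1 hI2]
    _ < ε := by
        have h1 := herr1 (Θ j)
        linarith

/-- **CIP 1994 Lemma 5.3.10 / 5.3.11 (i) for the DiPerna–Lions approximating sequence: velocity
averages converge strongly** (Cercignani–Illner–Pulvirenti 1994 §5.3 Lemma 5.3.10, p. 155, applied
as in the proof of Lemma 5.3.11, p. 155–156, with `β_δ(s) = δ⁻¹ ln(1 + δ s)` and Lemma 5.3.7;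
Lions 1993 Thm III.4 (47); DiPerna–Lions 1989). Granted the velocity averaging lemma CIP 5.3.9
(`velocityAverage_relativelyCompact_L1`): in the setting of `diPernaLions_extraction`, along the
extracted subsequence `f^{φ(k)} ⇀ f` (`IsDiPernaLionsWeakLimit`), for every `T` and every sequence
of weights `ψₖ` bounded in `L^∞((0,T) × E × E)` and converging a.e. to `ψ`,
`∫ f^{φ(k)} ψₖ dξ → ∫ f ψ dξ` in `L¹((0,T) × E)` (the whole sequence, no further extraction). [cite: CIPDiluteGases1994, §5.3 Lemma 5.3.10 and Lemma 5.3.11 (i) (pp. 155–156)]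
[cite: Lions1993Kinetic, Thm III.4 (47) (p. 57)] -/
theorem tendsto_integral_abs_velocityAverage_sub
    (h9 : velocityAverage_relativelyCompact_L1.{u})
    {B : E × E → sphere (0 : E) 1 → ℝ} (hB : KineticTheory.IsDiPernaLionsKernel B)
    {f₀ : E → E → ℝ} (hf₀ : HasDiPernaLionsData f₀)
    {δ : ℕ → ℝ} {Bseq : ℕ → E × E → sphere (0 : E) 1 → ℝ} {fseq : ℕ → ℝ → E → E → ℝ}
    (hδ : ∀ n, 0 < δ n) (hanti : Antitone δ) (hlim : Tendsto δ atTop (𝓝 0))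
    (hker : IsDiPernaLionsKernelApproximation B Bseq)
    (hdata : IsDiPernaLionsDataApproximation f₀ (fun n => fseq n 0))
    (hsol : ∀ n, IsDiPernaLionsApproximateSolution (δ n) (Bseq n) (fseq n))
    (hbd : UniformDiPernaLionsBounds δ Bseq fseq) {φ : ℕ → ℕ} {f : ℝ → E → E → ℝ}
    (hW : IsDiPernaLionsWeakLimit f₀ fseq φ f)
    {T : ℝ} {ψ : ℕ → ℝ × E × E → ℝ} {ψlim : ℝ × E × E → ℝ} {M : ℝ}
    (hψm : ∀ k, AEStronglyMeasurable (ψ k) (slabMeasure E T))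
    (hψM : ∀ k, ∀ᵐ z ∂(slabMeasure E T), |ψ k z| ≤ M)
    (hψlim : ∀ᵐ z ∂(slabMeasure E T), Tendsto (fun k => ψ k z) atTop (𝓝 (ψlim z))) :
    Tendsto (fun k => ∫ p, |velocityIntegral (ψ k) (fun z => fseq (φ k) z.1 z.2.1 z.2.2) p -
        velocityIntegral ψlim (fun z => f z.1 z.2.1 z.2.2) p| ∂(baseSlabMeasure E T)) atTop (𝓝 0) := by
  set a : ℕ → ℝ := fun k => ∫ p, |velocityIntegral (ψ k) (fun z => fseq (φ k) z.1 z.2.1 z.2.2) p -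
    velocityIntegral ψlim (fun z => f z.1 z.2.1 z.2.2) p| ∂(baseSlabMeasure E T) with hadef
  have ha0 : ∀ k, 0 ≤ a k := fun k => integral_nonneg fun p => abs_nonneg _
  rw [Metric.tendsto_atTop]
  intro ε hε
  by_contra hcon
  push Not at hcon
  have hfreq : ∃ᶠ k in atTop, ε ≤ a k := by
    rw [frequently_atTop]
    intro N
    obtain ⟨n, hn, hna⟩ := hcon N
    refine ⟨n, hn, ?_⟩
    rwa [Real.dist_eq, sub_zero, abs_of_nonneg (ha0 n)] at hna
  obtain ⟨θ, hθ, hθε⟩ := extraction_of_frequently_atTop hfreq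
  obtain ⟨j, hj⟩ := exists_integral_abs_velocityAverage_sub_lt h9 hB hf₀ hδ hanti hlim hker hdata hsol
    hbd hW hψm hψM hψlim hε hθ
  exact (not_lt.2 (hθε j)) hj

end Main

end Literature.MathematicalPhysics.KineticTheory

/-! ## CIP Lemma 5.3.11 (i): the velocity masses converge strongly and almost everywhere -/

namespace Literature.MathematicalPhysics.KineticTheory

open Literature.Analysis.FluidPDE Literature.Analysis.FunctionSpaces

section Mass

universe u

variable {E : Type u} [NormedAddCommGroup E] [InnerProductSpace ℝ E] [FiniteDimensional ℝ E]
  [MeasurableSpace E] [BorelSpace E]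

/-- The velocity average against the weight `1` is the velocity mass `∫ u(t, x, ξ) dξ`. [folklore] -/
theorem velocityIntegral_one (u : ℝ × E × E → ℝ) (p : ℝ × E) :
    velocityIntegral (fun _ => 1) u p = ∫ ξ, u (p.1, p.2, ξ) := by
  simp [velocityIntegral]

/-- **CIP 1994 Lemma 5.3.11 (i), `L¹` part**: granted Lemma 5.3.9, along the extracted subsequence
the velocity masses converge, `∫ f^{φ(k)} dξ → ∫ f dξ` in `L¹((0,T) × E)` for every `T`
("i) is immediate" from Lemma 5.3.10; Lions 1993 Thm III.4 (47) with `ψ = 1`). [cite: CIPDiluteGases1994, §5.3 Lemma 5.3.11 (i) (p. 155)] -/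
theorem tendsto_integral_abs_velocityMass_sub
    (h9 : velocityAverage_relativelyCompact_L1.{u})
    {B : E × E → sphere (0 : E) 1 → ℝ} (hB : KineticTheory.IsDiPernaLionsKernel B)
    {f₀ : E → E → ℝ} (hf₀ : HasDiPernaLionsData f₀)
    {δ : ℕ → ℝ} {Bseq : ℕ → E × E → sphere (0 : E) 1 → ℝ} {fseq : ℕ → ℝ → E → E → ℝ}
    (hδ : ∀ n, 0 < δ n) (hanti : Antitone δ) (hlim : Tendsto δ atTop (𝓝 0))
    (hker : IsDiPernaLionsKernelApproximation B Bseq)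
    (hdata : IsDiPernaLionsDataApproximation f₀ (fun n => fseq n 0))
    (hsol : ∀ n, IsDiPernaLionsApproximateSolution (δ n) (Bseq n) (fseq n))
    (hbd : UniformDiPernaLionsBounds δ Bseq fseq) {φ : ℕ → ℕ} {f : ℝ → E → E → ℝ}
    (hW : IsDiPernaLionsWeakLimit f₀ fseq φ f) (T : ℝ) :
    Tendsto (fun k => ∫ p : ℝ × E, |(∫ ξ, fseq (φ k) p.1 p.2 ξ) - ∫ ξ, f p.1 p.2 ξ|
      ∂(baseSlabMeasure E T)) atTop (𝓝 0) := by
  have h := tendsto_integral_abs_velocityAverage_sub h9 hB hf₀ hδ hanti hlim hker hdata hsol hbd hW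
    (T := T) (ψ := fun _ _ => (1 : ℝ)) (ψlim := fun _ => 1) (M := 1)
    (fun _ => aestronglyMeasurable_const) (fun _ => Eventually.of_forall fun _ => by simp)
    (Eventually.of_forall fun _ => tendsto_const_nhds)
  simpa only [velocityIntegral_one] using h

/-- **CIP 1994 Lemma 5.3.11 (i), almost-everywhere part**: granted Lemma 5.3.9, there is a further
subsequence along which `∫ f^{φ(n_k)} dξ → ∫ f dξ` almost everywhere on `(0,T) × E` for every `T`
(one subsequence for all `T`, by a diagonal extraction over `T ∈ ℕ`). [cite: CIPDiluteGases1994, §5.3 Lemma 5.3.11 (i) (p. 155)] -/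
theorem exists_subseq_velocityMass_tendsto_ae
    (h9 : velocityAverage_relativelyCompact_L1.{u})
    {B : E × E → sphere (0 : E) 1 → ℝ} (hB : KineticTheory.IsDiPernaLionsKernel B)
    {f₀ : E → E → ℝ} (hf₀ : HasDiPernaLionsData f₀)
    {δ : ℕ → ℝ} {Bseq : ℕ → E × E → sphere (0 : E) 1 → ℝ} {fseq : ℕ → ℝ → E → E → ℝ}
    (hδ : ∀ n, 0 < δ n) (hanti : Antitone δ) (hlim : Tendsto δ atTop (𝓝 0))
    (hker : IsDiPernaLionsKernelApproximation B Bseq)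
    (hdata : IsDiPernaLionsDataApproximation f₀ (fun n => fseq n 0))
    (hsol : ∀ n, IsDiPernaLionsApproximateSolution (δ n) (Bseq n) (fseq n))
    (hbd : UniformDiPernaLionsBounds δ Bseq fseq) {φ : ℕ → ℕ} {f : ℝ → E → E → ℝ}
    (hW : IsDiPernaLionsWeakLimit f₀ fseq φ f) :
    ∃ ns : ℕ → ℕ, StrictMono ns ∧ ∀ T : ℝ, ∀ᵐ p : ℝ × E ∂(baseSlabMeasure E T),
      Tendsto (fun k => ∫ ξ, fseq (φ (ns k)) p.1 p.2 ξ) atTop (𝓝 (∫ ξ, f p.1 p.2 ξ)) := by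
  -- the properties `P m θ`: a.e. convergence on the slab of height `m` along `θ`
  set V : ℕ → ℝ × E → ℝ := fun n p => ∫ ξ, fseq n p.1 p.2 ξ with hV
  set Vinf : ℝ × E → ℝ := fun p => ∫ ξ, f p.1 p.2 ξ with hVinf
  set P : ℕ → (ℕ → ℕ) → Prop := fun m θ => ∀ᵐ p : ℝ × E ∂(baseSlabMeasure E m),
    Tendsto (fun k => V (φ (θ k)) p) atTop (𝓝 (Vinf p)) with hP
  -- integrability of the velocity masses on slabs
  have hint : ∀ (T : ℝ) n, Integrable (V n) (baseSlabMeasure E T) := by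
    intro T n
    have h1 : Integrable (fun z : ℝ × E × E => fseq n z.1 z.2.1 z.2.2) (slabMeasure E T) :=
      integrable_of_uniformIntegrable (uniformIntegrable_unifTight_slab hsol hbd T).1 n
    exact (integrable_integral_velocity h1).1
  have hint' : ∀ T : ℝ, Integrable Vinf (baseSlabMeasure E T) := by
    intro T
    have h1 : Integrable (fun z : ℝ × E × E => f z.1 z.2.1 z.2.2) (slabMeasure E T) := by
      have := (hW.integrableOn_slab T).mono_set (prod_mono (Ioo_subset_Icc_self) (Subset.refl _))
      rw [slabMeasure_def]; exact this
    exact (integrable_integral_velocity h1).1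
  -- every subsequence has an a.e.-convergent further subsequence
  have hex : ∀ m (θ : ℕ → ℕ), StrictMono θ → ∃ θ' : ℕ → ℕ, StrictMono θ' ∧ P m (θ ∘ θ') := by
    intro m θ hθ
    have hWθ : IsDiPernaLionsWeakLimit f₀ fseq (φ ∘ θ) f :=
      { strictMono := hW.strictMono.comp hθ
        nonneg := hW.nonneg
        measurable := hW.measurable
        tendstoWeaklyL1_slab := fun T => (hW.tendstoWeaklyL1_slab T).comp_strictMono hθ
        tendstoWeaklyL1_slice := fun t ht => (hW.tendstoWeaklyL1_slice t ht).comp_strictMono hθ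
        initial_ae := hW.initial_ae
        tendsto_integral_abs_sub := hW.tendsto_integral_abs_sub
        massEntropy_le := hW.massEntropy_le }
    have hL1 := tendsto_integral_abs_velocityMass_sub h9 hB hf₀ hδ hanti hlim hker hdata hsol hbd hWθ m
    obtain ⟨θ', hθ', hae⟩ := exists_subseq_tendsto_ae_of_tendsto_integral_abs
      (fun k => hint m (φ (θ k))) (hint' m) hL1
    exact ⟨θ', hθ', hae⟩
  have hsub : ∀ m (θ θ' : ℕ → ℕ), StrictMono θ' → P m θ → P m (θ ∘ θ') := by
    intro m θ θ' hθ' hPθ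
    exact hPθ.mono fun p hp => hp.comp hθ'.tendsto_atTop
  have hshift : ∀ m (θ : ℕ → ℕ) (a : ℕ), P m (fun k => θ (k + a)) → P m θ := by
    intro m θ a hPθ
    exact hPθ.mono fun p hp => (Filter.tendsto_add_atTop_iff_nat a).1 hp
  obtain ⟨d, hd, hPd⟩ := exists_strictMono_diagonal hex hsub hshift id strictMono_id
  refine ⟨d, hd, fun T => ?_⟩
  -- from the slab of height `⌈T⌉₊` to the slab of height `T`
  have hle : baseSlabMeasure E T ≤ baseSlabMeasure E (⌈T⌉₊ : ℕ) := by
    rw [baseSlabMeasure_def, baseSlabMeasure_def]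
    exact Measure.restrict_mono (prod_mono (Ioo_subset_Ioo_right (Nat.le_ceil T)) Subset.rfl) le_rfl
  exact (hPd ⌈T⌉₊).filter_mono (ae_mono hle)

end Mass

end Literature.MathematicalPhysics.KineticTheory
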